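import Literature.Computability.Complexity.NumPrograms
import HarnessLib

/-!
# Numeric register programs, II: program logic and the integer toolkit

Literature / complexity toolkit, continuing `NumPrograms.lean` (the language `NCom`, its
instrumented semantics `NCom.eval` and the simulation theorem `NCom.runs`).  This file is the
first layer of *programs*: the reasoning principles used for every later program, and the
integer subroutines of Harvey's factoring machine (Harvey 2021, §2.1: gcd, modular powers,
integer roots), each a closed `NCom` term with a specification proved over `ℕ` only:

* reasoning: `NState.Frame` (registers outside a list are unchanged), the unfolding lemmas
  `eval_seq`, `eval_times`, `eval_ifPos_*`, …, and `iterate_inv` (invariants of counted loops);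
* `gcdP ρ` — Euclid's algorithm as a counted loop (`2 size b ≤ t` rounds suffice: the
  second argument at least halves every two rounds, `euclidStep_two_le`); **`gcdP_spec`**:
  `a := gcd a b`, `b := 0`, frame, `peak` unchanged, `steps ≤ steps + 5 t + 1`;
* `powModP ρ` — right-to-left binary powering `c^e mod m` in `size e` rounds; **`powModP_spec`**;
* `irootP ρ k` — `⌊x^{1/k}⌋` by bisection in `size (x+1)` rounds (**`irootP_spec`**:
  `r^k ≤ x < (r+1)^k`; `k = 2` is the integer square root), for the parameters `N^{1/5}`,
  `(N/r)^{1/2}`, … of the factoring algorithm;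
* queue utilities `moveN`, `emitK`, `teeN` with closed forms (`moveN_eq'`, `emitK_eq`,
  `teeN_eq`), and `pow2P` (the least power of two above a scalar, `pow2P_spec`, with the
  doubling loop in closed form `dblLoop_eq`).

All specifications have the same shape: the values of the result registers, a frame, the exact
final `peak` (or a bound) and a bound on `steps` linear in the loop count — the three facts the
simulation theorem turns into a machine step count.

## References

* D. E. Knuth, *The Art of Computer Programming*, Vol. 2, 3rd ed., Addison–Wesley 1998, §4.5.2
  (Euclid's algorithm; Lamé-type bounds), §4.6.3 (right-to-left binary method for powers),
  §4.5.4 answer 41-style bisection for roots. (Folklore material, fully proved here.)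
* D. Harvey, *An exponent one-fifth algorithm for deterministic integer factorisation*, Math.
  Comp. 90 (2021), §2.1 (the integer operations assumed: gcd, `⌊(x/y)^{u/v}⌋`, powers mod `N`)
  [Harvey2021].
-/

namespace Literature.Computability.Complexity

open _root_.Computability

/-! ### Frames -/

namespace NState

variable {S V O : Type}

/-- `Frame σ τ ss vs os`: outside the listed registers, `τ` agrees with `σ`. [folklore] -/
structure Frame (σ τ : NState S V O) (ss : List S) (vs : List V) (os : List O) : Prop where
  sc : ∀ s, s ∉ ss → τ.sc s = σ.sc s
  vi : ∀ v, v ∉ vs → τ.vi v = σ.vi v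
  vo : ∀ o, o ∉ os → τ.vo o = σ.vo o

/-- Frames are reflexive. [folklore] -/
theorem Frame.refl (σ : NState S V O) (ss : List S) (vs : List V) (os : List O) : Frame σ σ ss vs os :=
  ⟨fun _ _ => rfl, fun _ _ => rfl, fun _ _ => rfl⟩

/-- Frames compose. [folklore] -/
theorem Frame.trans {σ τ υ : NState S V O} {ss ss' : List S} {vs vs' : List V} {os os' : List O}
    (h₁ : Frame σ τ ss vs os) (h₂ : Frame τ υ ss' vs' os') : Frame σ υ (ss ++ ss') (vs ++ vs') (os ++ os') :=
  ⟨fun s hs => by rw [List.mem_append, not_or] at hs; rw [h₂.sc s hs.2, h₁.sc s hs.1],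
   fun v hv => by rw [List.mem_append, not_or] at hv; rw [h₂.vi v hv.2, h₁.vi v hv.1],
   fun o ho => by rw [List.mem_append, not_or] at ho; rw [h₂.vo o ho.2, h₁.vo o ho.1]⟩

/-- Frames weaken to larger lists. [folklore] -/
theorem Frame.mono {σ τ : NState S V O} {ss ss' : List S} {vs vs' : List V} {os os' : List O}
    (h : Frame σ τ ss vs os) (hs : ss ⊆ ss') (hv : vs ⊆ vs') (ho : os ⊆ os') : Frame σ τ ss' vs' os' :=
  ⟨fun s hs' => h.sc s fun h' => hs' (hs h'), fun v hv' => h.vi v fun h' => hv' (hv h'),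
   fun o ho' => h.vo o fun h' => ho' (ho h')⟩

/-- `bump` changes no register. [folklore] -/
theorem frame_bump (σ : NState S V O) (a k : ℕ) (ss : List S) (vs : List V) (os : List O) :
    Frame σ (σ.bump a k) ss vs os :=
  ⟨fun _ _ => rfl, fun _ _ => rfl, fun _ _ => rfl⟩

/-- Writing a listed scalar. [folklore] -/
theorem frame_setSc [DecidableEq S] (σ : NState S V O) {x : S} {ss : List S} (hx : x ∈ ss) (a : ℕ)
    (vs : List V) (os : List O) : Frame σ (σ.setSc x a) ss vs os :=
  ⟨fun s hs => by rw [sc_setSc, Function.update_of_ne]; rintro rfl; exact hs hx, fun _ _ => rfl, fun _ _ => rfl⟩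

/-- Writing a listed queue. [folklore] -/
theorem frame_setVi [DecidableEq V] (σ : NState S V O) {v : V} {vs : List V} (hv : v ∈ vs) (l : List ℕ)
    (ss : List S) (os : List O) : Frame σ (σ.setVi v l) ss vs os :=
  ⟨fun _ _ => rfl, fun w hw => by rw [vi_setVi, Function.update_of_ne]; rintro rfl; exact hw hv, fun _ _ => rfl⟩

/-- Extensionality of abstract states. [folklore] -/
@[ext] theorem ext {σ τ : NState S V O} (h₁ : σ.sc = τ.sc) (h₂ : σ.vi = τ.vi) (h₃ : σ.vo = τ.vo) (h₄ : σ.peak = τ.peak)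
    (h₅ : σ.steps = τ.steps) : σ = τ := by
  cases σ; cases τ; simp only at h₁ h₂ h₃ h₄ h₅; subst h₁ h₂ h₃ h₄ h₅; rfl

/-- Writing a listed accumulator. [folklore] -/
theorem frame_setVo [DecidableEq O] (σ : NState S V O) {o : O} {os : List O} (ho : o ∈ os) (l : List ℕ)
    (ss : List S) (vs : List V) : Frame σ (σ.setVo o l) ss vs os :=
  ⟨fun _ _ => rfl, fun _ _ => rfl, fun w hw => by rw [vo_setVo, Function.update_of_ne]; rintro rfl; exact hw ho⟩

end NState

namespace NCom

variable {S V O X E : Type} [DecidableEq S] [DecidableEq V] [DecidableEq O]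
variable (𝓔 : NExt S V O X E)

/-! ### Unfolding the semantics -/

/-- Sequencing. [folklore] -/
@[simp] theorem eval_seq (c₁ c₂ : NCom S V O E) (σ : NState S V O) :
    (c₁ ;ₙ c₂).eval 𝓔 σ = c₂.eval 𝓔 (c₁.eval 𝓔 σ) := rfl

/-- `skip`. [folklore] -/
@[simp] theorem eval_skip (σ : NState S V O) : (skip : NCom S V O E).eval 𝓔 σ = σ := rfl

/-- Counted loops iterate the body. [folklore] -/
theorem eval_times (x : S) (c : NCom S V O E) (σ : NState S V O) :
    (times x c).eval 𝓔 σ = (c.eval 𝓔)^[σ.sc x] (σ.bump 0 (σ.sc x + 1)) := rfl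

/-- `ifPos` on a positive scalar. [folklore] -/
theorem eval_ifPos_pos {x : S} (c₁ c₂ : NCom S V O E) {σ : NState S V O} (h : 0 < σ.sc x) :
    (ifPos x c₁ c₂).eval 𝓔 σ = c₁.eval 𝓔 (σ.bump 0 1) := by
  show (if 0 < σ.sc x then _ else _) = _; rw [if_pos h]

/-- `ifPos` on a zero scalar. [folklore] -/
theorem eval_ifPos_zero {x : S} (c₁ c₂ : NCom S V O E) {σ : NState S V O} (h : σ.sc x = 0) :
    (ifPos x c₁ c₂).eval 𝓔 σ = c₂.eval 𝓔 (σ.bump 0 1) := by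
  show (if 0 < σ.sc x then _ else _) = _; rw [if_neg (by omega)]

/-- `ifLt`, true branch. [folklore] -/
theorem eval_ifLt_lt {y z : S} (c₁ c₂ : NCom S V O E) {σ : NState S V O} (h : σ.sc y < σ.sc z) :
    (ifLt y z c₁ c₂).eval 𝓔 σ = c₁.eval 𝓔 (σ.bump 0 1) := by
  show (if σ.sc y < σ.sc z then _ else _) = _; rw [if_pos h]

/-- `ifLt`, false branch. [folklore] -/
theorem eval_ifLt_ge {y z : S} (c₁ c₂ : NCom S V O E) {σ : NState S V O} (h : σ.sc z ≤ σ.sc y) :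
    (ifLt y z c₁ c₂).eval 𝓔 σ = c₂.eval 𝓔 (σ.bump 0 1) := by
  show (if σ.sc y < σ.sc z then _ else _) = _; rw [if_neg (by omega)]

/-- `ifEmpty`, empty queue. [folklore] -/
theorem eval_ifEmpty_nil {v : V} (c₁ c₂ : NCom S V O E) {σ : NState S V O} (h : σ.vi v = []) :
    (ifEmpty v c₁ c₂).eval 𝓔 σ = c₁.eval 𝓔 (σ.bump 0 1) := by
  show (if σ.vi v = [] then _ else _) = _; rw [if_pos h]

/-- `ifEmpty`, nonempty queue. [folklore] -/
theorem eval_ifEmpty_cons {v : V} (c₁ c₂ : NCom S V O E) {σ : NState S V O} (h : σ.vi v ≠ []) :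
    (ifEmpty v c₁ c₂).eval 𝓔 σ = c₂.eval 𝓔 (σ.bump 0 1) := by
  show (if σ.vi v = [] then _ else _) = _; rw [if_neg h]

omit [DecidableEq S] [DecidableEq V] [DecidableEq O] in
/-- **Invariants of iterates**: an indexed invariant preserved by one step holds after `n`
steps. [folklore] -/
theorem iterate_inv {α : Type} (f : α → α) (P : ℕ → α → Prop) (h : ∀ j a, P j a → P (j + 1) (f a))
    {a : α} (h0 : P 0 a) : ∀ n, P n (f^[n] a)
  | 0 => h0
  | n + 1 => by rw [Function.iterate_succ_apply']; exact h _ _ (iterate_inv f P h h0 n)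

omit [DecidableEq S] [DecidableEq V] [DecidableEq O] in
/-- A fixed point stays fixed under iteration. [folklore] -/
theorem iterate_fixed {α : Type} {f : α → α} {a : α} (h : f a = a) (n : ℕ) : f^[n] a = a :=
  Function.iterate_fixed h n

/-! ### Programs without extension calls -/

/-- `c` contains no extension opcode. [folklore] -/
def noExt : NCom S V O E → Prop
  | seq c₁ c₂ => noExt c₁ ∧ noExt c₂
  | ifPos _ c₁ c₂ => noExt c₁ ∧ noExt c₂
  | ifLt _ _ c₁ c₂ => noExt c₁ ∧ noExt c₂
  | ifEmpty _ c₁ c₂ => noExt c₁ ∧ noExt c₂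
  | times _ c => noExt c
  | ext _ => False
  | _ => True

/-- A program without extension opcodes meets all their preconditions. [folklore] -/
theorem extOK_of_noExt : ∀ {c : NCom S V O E}, c.noExt → ∀ (σ : NState S V O), c.extOK 𝓔 σ
  | seq _ _, h, σ => ⟨extOK_of_noExt h.1 σ, extOK_of_noExt h.2 _⟩
  | ifPos _ _ _, h, σ => by unfold extOK; split; exacts [extOK_of_noExt h.1 _, extOK_of_noExt h.2 _]
  | ifLt _ _ _ _, h, σ => by unfold extOK; split; exacts [extOK_of_noExt h.1 _, extOK_of_noExt h.2 _]
  | ifEmpty _ _ _, h, σ => by unfold extOK; split; exacts [extOK_of_noExt h.1 _, extOK_of_noExt h.2 _]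
  | times _ c, h, σ => fun _ _ => extOK_of_noExt (c := c) h _
  | ext _, h, _ => h.elim
  | setc _ _, _, _ => trivial
  | mov _ _, _, _ => trivial
  | add _ _ _, _, _ => trivial
  | sub _ _ _, _, _ => trivial
  | mul _ _ _, _, _ => trivial
  | divmod _ _ _ _, _, _ => trivial
  | sizeOf _ _, _, _ => trivial
  | pop _ _, _, _ => trivial
  | push _ _, _, _ => trivial
  | emit _ _, _, _ => trivial
  | pour _ _, _, _ => trivial
  | clearV _, _, _ => trivial
  | clearO _, _, _ => trivial
  | skip, _, _ => trivial

/-- `extOK` of a sequence. [folklore] -/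
@[simp] theorem extOK_seq (c₁ c₂ : NCom S V O E) (σ : NState S V O) :
    (c₁ ;ₙ c₂).extOK 𝓔 σ ↔ c₁.extOK 𝓔 σ ∧ c₂.extOK 𝓔 (c₁.eval 𝓔 σ) := Iff.rfl

/-- `extOK` of an extension call. [folklore] -/
@[simp] theorem extOK_ext (e : E) (σ : NState S V O) : (ext e : NCom S V O E).extOK 𝓔 σ ↔ 𝓔.pre e σ := Iff.rfl

/-- `extOK` of a counted loop. [folklore] -/
theorem extOK_times (x : S) (c : NCom S V O E) (σ : NState S V O) :
    (times x c).extOK 𝓔 σ ↔ ∀ j < σ.sc x, c.extOK 𝓔 ((c.eval 𝓔)^[j] (σ.bump 0 (σ.sc x + 1))) := Iff.rfl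

/-! ### Role embeddings -/

omit [DecidableEq S] [DecidableEq V] [DecidableEq O] in
/-- Distinct roles name distinct registers (the form in which `simp` decides register
(in)equalities of a subroutine whose registers are given by an embedding of its roles).
[folklore] -/
theorem role_ne {R : Type} (ρ : R ↪ S) {i j : R} (h : i ≠ j) : ρ i ≠ ρ j := fun e => h (ρ.injective e)

/-! ### Euclid's algorithm -/

/-- One round of Euclid's algorithm on a pair: `(A, B) ↦ (B, A mod B)` if `B ≠ 0`. [folklore] -/
def euclidStep (p : ℕ × ℕ) : ℕ × ℕ := if p.2 = 0 then p else (p.2, p.1 % p.2)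

omit [DecidableEq S] [DecidableEq V] [DecidableEq O] in
/-- Euclid's rounds preserve the gcd. [folklore] -/
theorem gcd_euclidStep (p : ℕ × ℕ) : Nat.gcd (euclidStep p).1 (euclidStep p).2 = Nat.gcd p.1 p.2 := by
  unfold euclidStep
  split_ifs with h
  · rfl
  · simp only; rw [Nat.gcd_comm p.1, Nat.gcd_rec p.2 p.1, Nat.gcd_comm]

omit [DecidableEq S] [DecidableEq V] [DecidableEq O] in
/-- `(A, 0)` is fixed. [folklore] -/
theorem euclidStep_of_zero {p : ℕ × ℕ} (h : p.2 = 0) : euclidStep p = p := if_pos h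

omit [DecidableEq S] [DecidableEq V] [DecidableEq O] in
/-- **Two rounds at least halve the second component.** [Knuth 1998, §4.5.3 (cf. Lamé)]
[folklore] -/
theorem euclidStep_two_le (p : ℕ × ℕ) : (euclidStep (euclidStep p)).2 ≤ p.2 / 2 := by
  obtain ⟨A, B⟩ := p
  by_cases hB : B = 0
  · simp [euclidStep, hB]
  simp only [euclidStep, hB, if_false]
  by_cases hC : A % B = 0
  · simp [hC]
  rw [if_neg hC]
  simp only
  set C := A % B with hCdef
  have hCB : C < B := Nat.mod_lt _ (Nat.pos_of_ne_zero hB)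
  by_cases hle : C ≤ B / 2
  · have := Nat.mod_lt B (Nat.pos_of_ne_zero hC); omega
  · have h1 : B / C = 1 := by
      apply Nat.div_eq_of_lt_le <;> omega
    have h2 : B % C = B - C := by
      have := Nat.mod_add_div B C; rw [h1, Nat.mul_one] at this; omega
    rw [h2]; omega

omit [DecidableEq S] [DecidableEq V] [DecidableEq O] in
/-- After `2 k` rounds the second component is at most `B / 2^k`. [folklore] -/
theorem euclidStep_iterate_le (p : ℕ × ℕ) : ∀ k, (euclidStep^[2 * k] p).2 ≤ p.2 / 2 ^ k
  | 0 => by simp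
  | k + 1 => by
    rw [show 2 * (k + 1) = 2 * k + 1 + 1 by ring, Function.iterate_succ_apply', Function.iterate_succ_apply', pow_succ,
      ← Nat.div_div_eq_div_mul]
    exact (euclidStep_two_le _).trans (Nat.div_le_div_right (euclidStep_iterate_le p k))

omit [DecidableEq S] [DecidableEq V] [DecidableEq O] in
/-- After `2 size B` rounds (or more) Euclid's algorithm has stopped: the pair is
`(gcd A B, 0)`. [Knuth 1998, §4.5.2–4.5.3] [folklore] -/
theorem euclidStep_iterate_eq (A B : ℕ) {n : ℕ} (hn : 2 * B.size ≤ n) :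
    euclidStep^[n] (A, B) = (Nat.gcd A B, 0) := by
  have hgcd : ∀ m, Nat.gcd (euclidStep^[m] (A, B)).1 (euclidStep^[m] (A, B)).2 = Nat.gcd A B := by
    intro m
    induction m with
    | zero => rfl
    | succ m ih => rw [Function.iterate_succ_apply', gcd_euclidStep, ih]
  have hzero : (euclidStep^[2 * B.size] (A, B)).2 = 0 := by
    have h := euclidStep_iterate_le (A, B) B.size
    have : B / 2 ^ B.size = 0 := Nat.div_eq_of_lt (Nat.lt_size_self B)
    simp only [this, Nat.le_zero] at h; exact h
  obtain ⟨d, rfl⟩ := Nat.exists_eq_add_of_le hn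
  rw [Nat.add_comm, Function.iterate_add_apply]
  have hfix : euclidStep^[d] (euclidStep^[2 * B.size] (A, B)) = euclidStep^[2 * B.size] (A, B) :=
    Function.iterate_fixed (euclidStep_of_zero hzero) d
  rw [hfix]
  have hg := hgcd (2 * B.size)
  rw [hzero, Nat.gcd_zero_right] at hg
  ext
  · exact hg
  · exact hzero

/-- The roles of `gcdP`: the operands `a, b`, the quotient and remainder scratch `q, r`, and
the loop count `t`. [folklore] -/
inductive GcdR where
  | a | b | q | r | t
  deriving DecidableEq, Fintype, Repr

section Gcd

variable (ρ : GcdR ↪ S)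

/-- The loop body of `gcdP`: if `b ≠ 0` then `(a, b) := (b, a mod b)`. [folklore] -/
def gcdBody : NCom S V O E :=
  ifPos (ρ .b) (divmod (ρ .q) (ρ .r) (ρ .a) (ρ .b) ;ₙ mov (ρ .a) (ρ .b) ;ₙ mov (ρ .b) (ρ .r)) skip

/-- **Euclid's algorithm** as a numeric program: `t` rounds of `gcdBody`. [Knuth 1998, §4.5.2,
Algorithm A] [folklore] -/
def gcdP : NCom S V O E := times (ρ .t) (gcdBody ρ)

omit [DecidableEq S] [DecidableEq V] [DecidableEq O] in
/-- `gcdP` has no extension calls. [folklore] -/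
theorem gcdP_noExt : (gcdP ρ : NCom S V O E).noExt := by simp [gcdP, gcdBody, noExt]

/-- One round of `gcdP` on the abstract state. [folklore] -/
theorem gcdBody_spec (σ : NState S V O) :
    let τ := (gcdBody ρ : NCom S V O E).eval 𝓔 σ
    (τ.sc (ρ .a), τ.sc (ρ .b)) = euclidStep (σ.sc (ρ .a), σ.sc (ρ .b)) ∧
      (∀ s, s ≠ ρ .a → s ≠ ρ .b → s ≠ ρ .q → s ≠ ρ .r → τ.sc s = σ.sc s) ∧ τ.vi = σ.vi ∧ τ.vo = σ.vo ∧
      τ.peak = σ.peak ∧ τ.steps ≤ σ.steps + 4 := by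
  intro τ
  by_cases hb : 0 < σ.sc (ρ .b)
  · have hτ : τ = ((divmod (ρ .q) (ρ .r) (ρ .a) (ρ .b) ;ₙ mov (ρ .a) (ρ .b) ;ₙ mov (ρ .b) (ρ .r) : NCom S V O E)).eval 𝓔
        (σ.bump 0 1) := eval_ifPos_pos 𝓔 _ _ hb
    have hst : euclidStep (σ.sc (ρ .a), σ.sc (ρ .b)) = (σ.sc (ρ .b), σ.sc (ρ .a) % σ.sc (ρ .b)) := if_neg (by simp; omega)
    rw [hst]
    refine ⟨?_, fun s hsa hsb hsq hsr => ?_, by simp [hτ, eval], by simp [hτ, eval], by simp [hτ, eval], by simp [hτ, eval]⟩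
    · simp [hτ, eval]
    · simp [hτ, eval, hsa, hsb, hsq, hsr]
  · have hb0 : σ.sc (ρ .b) = 0 := by omega
    have hτ : τ = σ.bump 0 1 := eval_ifPos_zero 𝓔 _ _ hb0
    have hst : euclidStep (σ.sc (ρ .a), σ.sc (ρ .b)) = (σ.sc (ρ .a), σ.sc (ρ .b)) := if_pos (by simp [hb0])
    rw [hst, hτ]
    simp

/-- `j` rounds of `gcdP` perform `j` Euclid rounds. [folklore] -/
theorem gcdBody_iterate (σ : NState S V O) :
    ∀ j, let υ := ((gcdBody ρ : NCom S V O E).eval 𝓔)^[j] σ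
      (υ.sc (ρ .a), υ.sc (ρ .b)) = euclidStep^[j] (σ.sc (ρ .a), σ.sc (ρ .b)) ∧
        (∀ s, s ≠ ρ .a → s ≠ ρ .b → s ≠ ρ .q → s ≠ ρ .r → υ.sc s = σ.sc s) ∧ υ.vi = σ.vi ∧ υ.vo = σ.vo ∧
        υ.peak = σ.peak ∧ υ.steps ≤ σ.steps + 4 * j
  | 0 => ⟨rfl, fun _ _ _ _ _ => rfl, rfl, rfl, rfl, by simp⟩
  | j + 1 => by
    obtain ⟨h1, h2, h3, h4, h5, h6⟩ := gcdBody_iterate σ j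
    obtain ⟨r1, r2, r3, r4, r5, r6⟩ := gcdBody_spec 𝓔 ρ (((gcdBody ρ : NCom S V O E).eval 𝓔)^[j] σ)
    intro υ
    have hυ : υ = (gcdBody ρ : NCom S V O E).eval 𝓔 (((gcdBody ρ : NCom S V O E).eval 𝓔)^[j] σ) :=
      Function.iterate_succ_apply' _ _ _
    rw [hυ, Function.iterate_succ_apply', ← h1]
    exact ⟨r1, fun s hsa hsb hsq hsr => (r2 s hsa hsb hsq hsr).trans (h2 s hsa hsb hsq hsr), r3.trans h3, r4.trans h4,
      r5.trans h5, by omega⟩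

/-- **Specification of `gcdP`.**  With `t ≥ 2 · size b` rounds: `a := gcd a b`, `b := 0`, the
scratch `q, r` arbitrary, every other register unchanged, `peak` unchanged, and
`steps ≤ steps + 5 t + 1`. [Knuth 1998, §4.5.2–4.5.3] [folklore] -/
theorem gcdP_spec (σ : NState S V O) (ht : 2 * (σ.sc (ρ .b)).size ≤ σ.sc (ρ .t)) :
    let τ := (gcdP ρ : NCom S V O E).eval 𝓔 σ
    τ.sc (ρ .a) = Nat.gcd (σ.sc (ρ .a)) (σ.sc (ρ .b)) ∧ τ.sc (ρ .b) = 0 ∧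
      (∀ s, s ≠ ρ .a → s ≠ ρ .b → s ≠ ρ .q → s ≠ ρ .r → τ.sc s = σ.sc s) ∧ τ.vi = σ.vi ∧ τ.vo = σ.vo ∧
      τ.peak = σ.peak ∧ τ.steps ≤ σ.steps + 5 * σ.sc (ρ .t) + 1 := by
  intro τ
  have hτ : τ = ((gcdBody ρ : NCom S V O E).eval 𝓔)^[σ.sc (ρ .t)] (σ.bump 0 (σ.sc (ρ .t) + 1)) := rfl
  obtain ⟨h1, h2, h3, h4, h5, h6⟩ := gcdBody_iterate 𝓔 ρ (σ.bump 0 (σ.sc (ρ .t) + 1)) (σ.sc (ρ .t))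
  simp only [NState.sc_bump, NState.vi_bump, NState.vo_bump, NState.peak_bump, NState.steps_bump, Nat.max_zero]
    at h1 h2 h3 h4 h5 h6
  rw [euclidStep_iterate_eq _ _ ht] at h1
  rw [hτ]
  exact ⟨(Prod.mk.inj h1).1, (Prod.mk.inj h1).2, h2, h3, h4, h5, by omega⟩

end Gcd

/-! ### Modular powers by the binary method -/

/-- One round of right-to-left binary powering on `(res, c, e)` modulo `m`: multiply the result
by the current square if the low bit of `e` is set, square, halve `e`. [Knuth 1998, §4.6.3,
Algorithm A] [folklore] -/
def pmStep (m : ℕ) (p : ℕ × ℕ × ℕ) : ℕ × ℕ × ℕ :=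
  (if p.2.2 % 2 = 1 then p.1 * p.2.1 % m else p.1, p.2.1 * p.2.1 % m, p.2.2 / 2)

omit [DecidableEq S] [DecidableEq V] [DecidableEq O] in
/-- **Invariant of binary powering**: after `j` rounds from `(1, c, e)` (with `c < m`, `1 < m`),
the triple is `(c ^ (e mod 2^j) mod m, c ^ (2^j) mod m, e / 2^j)`. [Knuth 1998, §4.6.3] [folklore] -/
theorem pmStep_iterate {m c e : ℕ} (hm : 1 < m) (hc : c < m) :
    ∀ j, (pmStep m)^[j] (1, c, e) = (c ^ (e % 2 ^ j) % m, c ^ (2 ^ j) % m, e / 2 ^ j)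
  | 0 => by
    simp only [Function.iterate_zero, id_eq, pow_zero, Nat.mod_one, pow_one, Nat.div_one, Nat.mod_eq_of_lt hm,
      Nat.mod_eq_of_lt hc]
  | j + 1 => by
    rw [Function.iterate_succ_apply', pmStep_iterate hm hc j, pmStep]
    simp only
    have h2 : e % 2 ^ (j + 1) = e % 2 ^ j + 2 ^ j * (e / 2 ^ j % 2) := by
      rw [Nat.mod_pow_succ]
    ext
    · simp only
      rw [h2]
      split_ifs with hbit
      · rw [hbit, Nat.mul_one, pow_add, Nat.mul_mod, Nat.mod_mod, Nat.mod_mod, ← Nat.mul_mod]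
      · have h0 : e / 2 ^ j % 2 = 0 := by omega
        rw [h0, Nat.mul_zero, Nat.add_zero]
    · simp only
      rw [← Nat.mul_mod, ← pow_add, ← two_mul, ← pow_succ']
    · simp only
      rw [Nat.div_div_eq_div_mul, ← pow_succ]

/-- The roles of `powModP`: result `res`, running square `c`, remaining exponent `e`, modulus
`m`, the constant `two`, quotient scratch `q`, the current bit `bit`, product scratch `tmp`,
loop count `t`. [folklore] -/
inductive PowR where
  | res | c | e | m | two | q | bit | tmp | t
  deriving DecidableEq, Fintype, Repr

section PowMod

variable (ρ : PowR ↪ S)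

/-- The loop body of `powModP`. [folklore] -/
def powModBody : NCom S V O E :=
  divmod (ρ .q) (ρ .bit) (ρ .e) (ρ .two) ;ₙ mov (ρ .e) (ρ .q) ;ₙ
  ifPos (ρ .bit) (mul (ρ .tmp) (ρ .res) (ρ .c) ;ₙ divmod (ρ .q) (ρ .res) (ρ .tmp) (ρ .m)) skip ;ₙ
  mul (ρ .tmp) (ρ .c) (ρ .c) ;ₙ divmod (ρ .q) (ρ .c) (ρ .tmp) (ρ .m)

/-- **Modular powering** `res := c ^ e mod m` by the right-to-left binary method in
`t ≥ size e` rounds (`c` ends as a square, `e` as `0`). [Knuth 1998, §4.6.3, Algorithm A]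
[folklore] -/
def powModP : NCom S V O E :=
  setc (ρ .res) 1 ;ₙ setc (ρ .two) 2 ;ₙ times (ρ .t) (powModBody ρ)

omit [DecidableEq S] [DecidableEq V] [DecidableEq O] in
/-- `powModP` has no extension calls. [folklore] -/
theorem powModP_noExt : (powModP ρ : NCom S V O E).noExt := by simp [powModP, powModBody, noExt]

/-- One round of `powModBody`. [folklore] -/
theorem powModBody_spec (σ : NState S V O) (htwo : σ.sc (ρ .two) = 2) (hres : σ.sc (ρ .res) < σ.sc (ρ .m))
    (hc : σ.sc (ρ .c) < σ.sc (ρ .m)) :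
    let τ := (powModBody ρ : NCom S V O E).eval 𝓔 σ
    (τ.sc (ρ .res), τ.sc (ρ .c), τ.sc (ρ .e)) = pmStep (σ.sc (ρ .m)) (σ.sc (ρ .res), σ.sc (ρ .c), σ.sc (ρ .e)) ∧
      τ.sc (ρ .m) = σ.sc (ρ .m) ∧ τ.sc (ρ .two) = 2 ∧ τ.sc (ρ .t) = σ.sc (ρ .t) ∧
      (∀ s, (∀ i, s ≠ ρ i) → τ.sc s = σ.sc s) ∧ τ.vi = σ.vi ∧ τ.vo = σ.vo ∧
      τ.peak ≤ max σ.peak (σ.sc (ρ .m) * σ.sc (ρ .m)) ∧ τ.steps ≤ σ.steps + 7 := by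
  intro τ
  have hm : 0 < σ.sc (ρ .m) := by omega
  by_cases hbit : σ.sc (ρ .e) % 2 = 1
  · have hτ : τ = ((mul (ρ .tmp) (ρ .c) (ρ .c) ;ₙ divmod (ρ .q) (ρ .c) (ρ .tmp) (ρ .m) : NCom S V O E)).eval 𝓔
        (((mul (ρ .tmp) (ρ .res) (ρ .c) ;ₙ divmod (ρ .q) (ρ .res) (ρ .tmp) (ρ .m) : NCom S V O E)).eval 𝓔
          ((((divmod (ρ .q) (ρ .bit) (ρ .e) (ρ .two) ;ₙ mov (ρ .e) (ρ .q) : NCom S V O E)).eval 𝓔 σ).bump 0 1)) := by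
      show ((_ ;ₙ _ ;ₙ ifPos _ _ _ ;ₙ _ : NCom S V O E)).eval 𝓔 σ = _
      rw [eval_seq, eval_seq, eval_seq, eval_ifPos_pos]
      · rfl
      · simp [eval, htwo, hbit]
    have hps : pmStep (σ.sc (ρ .m)) (σ.sc (ρ .res), σ.sc (ρ .c), σ.sc (ρ .e)) =
        (σ.sc (ρ .res) * σ.sc (ρ .c) % σ.sc (ρ .m), σ.sc (ρ .c) * σ.sc (ρ .c) % σ.sc (ρ .m), σ.sc (ρ .e) / 2) := by
      simp [pmStep, hbit]
    rw [hps]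
    refine ⟨?_, ?_, ?_, ?_, fun s hs => ?_, ?_, ?_, ?_, ?_⟩
    · simp [hτ, eval, htwo]
    · simp [hτ, eval]
    · simp [hτ, eval, htwo]
    · simp [hτ, eval]
    · simp [hτ, eval, hs]
    · simp [hτ, eval]
    · simp [hτ, eval]
    · simp only [hτ, eval, NState.peak_bump, NState.peak_setSc, NState.sc_bump, NState.sc_setSc, Function.update_apply]
      simp only [EmbeddingLike.apply_eq_iff_eq, reduceCtorEq, if_false, if_true, htwo, Nat.max_zero]
      have h1 : σ.sc (ρ .res) * σ.sc (ρ .c) ≤ σ.sc (ρ .m) * σ.sc (ρ .m) := Nat.mul_le_mul hres.le hc.le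
      have h2 : σ.sc (ρ .c) * σ.sc (ρ .c) ≤ σ.sc (ρ .m) * σ.sc (ρ .m) := Nat.mul_le_mul hc.le hc.le
      simp only [max_le_iff, le_max_iff]
      omega
    · simp [hτ, eval]
  · have hbit0 : σ.sc (ρ .e) % 2 = 0 := by omega
    have hτ : τ = ((mul (ρ .tmp) (ρ .c) (ρ .c) ;ₙ divmod (ρ .q) (ρ .c) (ρ .tmp) (ρ .m) : NCom S V O E)).eval 𝓔
        ((((divmod (ρ .q) (ρ .bit) (ρ .e) (ρ .two) ;ₙ mov (ρ .e) (ρ .q) : NCom S V O E)).eval 𝓔 σ).bump 0 1) := by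
      show ((_ ;ₙ _ ;ₙ ifPos _ _ _ ;ₙ _ : NCom S V O E)).eval 𝓔 σ = _
      rw [eval_seq, eval_seq, eval_seq, eval_ifPos_zero]
      · rfl
      · simp [eval, htwo, hbit0]
    have hps : pmStep (σ.sc (ρ .m)) (σ.sc (ρ .res), σ.sc (ρ .c), σ.sc (ρ .e)) =
        (σ.sc (ρ .res), σ.sc (ρ .c) * σ.sc (ρ .c) % σ.sc (ρ .m), σ.sc (ρ .e) / 2) := by
      simp [pmStep, hbit0]
    rw [hps]
    refine ⟨?_, ?_, ?_, ?_, fun s hs => ?_, ?_, ?_, ?_, ?_⟩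
    · simp [hτ, eval, htwo]
    · simp [hτ, eval]
    · simp [hτ, eval, htwo]
    · simp [hτ, eval]
    · simp [hτ, eval, hs]
    · simp [hτ, eval]
    · simp [hτ, eval]
    · simp only [hτ, eval, NState.peak_bump, NState.peak_setSc, NState.sc_bump, NState.sc_setSc, Function.update_apply]
      simp only [EmbeddingLike.apply_eq_iff_eq, reduceCtorEq, if_false, if_true, Nat.max_zero]
      have h2 : σ.sc (ρ .c) * σ.sc (ρ .c) ≤ σ.sc (ρ .m) * σ.sc (ρ .m) := Nat.mul_le_mul hc.le hc.le
      simp only [max_le_iff, le_max_iff]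
      omega
    · simp [hτ, eval]

omit [DecidableEq S] [DecidableEq V] [DecidableEq O] in
/-- A binary-powering round keeps the result and the square reduced. [folklore] -/
theorem pmStep_lt {m : ℕ} (hm : 0 < m) {p : ℕ × ℕ × ℕ} (h1 : p.1 < m) :
    (pmStep m p).1 < m ∧ (pmStep m p).2.1 < m := by
  unfold pmStep
  refine ⟨?_, Nat.mod_lt _ hm⟩
  simp only
  split_ifs
  · exact Nat.mod_lt _ hm
  · exact h1

/-- `j` rounds of `powModBody`. [folklore] -/
theorem powModBody_iterate (σ : NState S V O) (htwo : σ.sc (ρ .two) = 2) (hm : 1 < σ.sc (ρ .m))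
    (hres : σ.sc (ρ .res) < σ.sc (ρ .m)) (hc : σ.sc (ρ .c) < σ.sc (ρ .m)) :
    ∀ j, let υ := ((powModBody ρ : NCom S V O E).eval 𝓔)^[j] σ
      (υ.sc (ρ .res), υ.sc (ρ .c), υ.sc (ρ .e)) = (pmStep (σ.sc (ρ .m)))^[j] (σ.sc (ρ .res), σ.sc (ρ .c), σ.sc (ρ .e)) ∧
        υ.sc (ρ .res) < σ.sc (ρ .m) ∧ υ.sc (ρ .c) < σ.sc (ρ .m) ∧
        υ.sc (ρ .m) = σ.sc (ρ .m) ∧ υ.sc (ρ .two) = 2 ∧ υ.sc (ρ .t) = σ.sc (ρ .t) ∧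
        (∀ s, (∀ i, s ≠ ρ i) → υ.sc s = σ.sc s) ∧ υ.vi = σ.vi ∧ υ.vo = σ.vo ∧
        υ.peak ≤ max σ.peak (σ.sc (ρ .m) * σ.sc (ρ .m)) ∧ υ.steps ≤ σ.steps + 7 * j
  | 0 => ⟨rfl, hres, hc, rfl, htwo, rfl, fun _ _ => rfl, rfl, rfl, le_max_left _ _, by simp⟩
  | j + 1 => by
    obtain ⟨h1, hr, hcc, h2, h3, h4, h5, h6, h7, h8, h9⟩ := powModBody_iterate σ htwo hm hres hc j
    intro υ
    set υ₀ := ((powModBody ρ : NCom S V O E).eval 𝓔)^[j] σ with hυ₀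
    have hυ : υ = (powModBody ρ : NCom S V O E).eval 𝓔 υ₀ := Function.iterate_succ_apply' _ _ _
    rw [← h2] at hr hcc
    obtain ⟨r1, r2, r3, r4, r5, r6, r7, r8, r9⟩ := powModBody_spec 𝓔 ρ υ₀ h3 hr hcc
    rw [h2] at r1 r8 hr hcc
    have hlt := pmStep_lt (by omega : 0 < σ.sc (ρ .m)) (p := (υ₀.sc (ρ .res), υ₀.sc (ρ .c), υ₀.sc (ρ .e))) hr
    rw [← r1] at hlt
    rw [hυ, Function.iterate_succ_apply', ← h1]
    refine ⟨r1, hlt.1, hlt.2, r2.trans h2, r3, r4.trans h4, fun s hs => (r5 s hs).trans (h5 s hs), r6.trans h6, r7.trans h7,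
      ?_, by omega⟩
    exact r8.trans (max_le h8 (le_max_right _ _))

/-- **Specification of `powModP`.**  With `1 < m`, `c < m` and `t ≥ size e` rounds:
`res := c ^ e mod m`, `e := 0`, `two := 2`, `c` some residue, the scratch arbitrary, every
other register unchanged, `peak ≤ max peak m²`, `steps ≤ steps + 8 t + 3`.
[Knuth 1998, §4.6.3, Algorithm A] [folklore] -/
theorem powModP_spec (σ : NState S V O) (hm : 1 < σ.sc (ρ .m)) (hc : σ.sc (ρ .c) < σ.sc (ρ .m))
    (ht : (σ.sc (ρ .e)).size ≤ σ.sc (ρ .t)) :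
    let τ := (powModP ρ : NCom S V O E).eval 𝓔 σ
    τ.sc (ρ .res) = σ.sc (ρ .c) ^ σ.sc (ρ .e) % σ.sc (ρ .m) ∧ τ.sc (ρ .e) = 0 ∧
      τ.sc (ρ .m) = σ.sc (ρ .m) ∧ τ.sc (ρ .two) = 2 ∧ τ.sc (ρ .t) = σ.sc (ρ .t) ∧ τ.sc (ρ .c) < σ.sc (ρ .m) ∧
      (∀ s, (∀ i, s ≠ ρ i) → τ.sc s = σ.sc s) ∧ τ.vi = σ.vi ∧ τ.vo = σ.vo ∧
      τ.peak ≤ max σ.peak (σ.sc (ρ .m) * σ.sc (ρ .m)) ∧ τ.steps ≤ σ.steps + 8 * σ.sc (ρ .t) + 3 := by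
  intro τ
  -- the state entering the loop
  set σ₁ := (((setc (ρ .res) 1 ;ₙ setc (ρ .two) 2 : NCom S V O E)).eval 𝓔 σ).bump 0 (σ.sc (ρ .t) + 1) with hσ₁
  have hσt : ((setc (ρ .two) 2 : NCom S V O E).eval 𝓔 ((setc (ρ .res) 1 : NCom S V O E).eval 𝓔 σ)).sc (ρ .t) =
      σ.sc (ρ .t) := by simp [eval]
  have hτ : τ = ((powModBody ρ : NCom S V O E).eval 𝓔)^[σ.sc (ρ .t)] σ₁ := by
    show ((_ ;ₙ _ ;ₙ times _ _ : NCom S V O E)).eval 𝓔 σ = _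
    rw [eval_seq, eval_seq, eval_times, hσt]
    rfl
  have h1res : σ₁.sc (ρ .res) = 1 := by simp [hσ₁, eval]
  have h1two : σ₁.sc (ρ .two) = 2 := by simp [hσ₁, eval]
  have h1m : σ₁.sc (ρ .m) = σ.sc (ρ .m) := by simp [hσ₁, eval]
  have h1c : σ₁.sc (ρ .c) = σ.sc (ρ .c) := by simp [hσ₁, eval]
  have h1e : σ₁.sc (ρ .e) = σ.sc (ρ .e) := by simp [hσ₁, eval]
  have h1t : σ₁.sc (ρ .t) = σ.sc (ρ .t) := by simp [hσ₁, eval]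
  have h1s : ∀ s, (∀ i, s ≠ ρ i) → σ₁.sc s = σ.sc s := fun s hs => by simp [hσ₁, eval, hs]
  have h1vi : σ₁.vi = σ.vi := by simp [hσ₁, eval]
  have h1vo : σ₁.vo = σ.vo := by simp [hσ₁, eval]
  have h1pk : σ₁.peak = max σ.peak 2 := by simp [hσ₁, eval]
  have h1st : σ₁.steps = σ.steps + 2 + (σ.sc (ρ .t) + 1) := by simp [hσ₁, eval]
  obtain ⟨i1, i2, i3, i4, i5, i6, i7, i8, i9, i10, i11⟩ :=
    powModBody_iterate 𝓔 ρ σ₁ h1two (by rw [h1m]; exact hm) (by rw [h1res, h1m]; exact hm) (by rw [h1c, h1m]; exact hc)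
      (σ.sc (ρ .t))
  rw [h1res, h1c, h1e, h1m, pmStep_iterate hm hc] at i1
  rw [← hτ] at i1 i2 i3 i4 i5 i6 i7 i8 i9 i10 i11
  obtain ⟨e1, e2, e3⟩ : τ.sc (ρ .res) = _ ∧ τ.sc (ρ .c) = _ ∧ τ.sc (ρ .e) = _ :=
    ⟨(Prod.mk.inj i1).1, (Prod.mk.inj (Prod.mk.inj i1).2).1, (Prod.mk.inj (Prod.mk.inj i1).2).2⟩
  have hpow : 2 ^ σ.sc (ρ .t) > σ.sc (ρ .e) := Nat.lt_of_lt_of_le (Nat.lt_size_self _) (Nat.pow_le_pow_right (by norm_num) ht)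
  refine ⟨?_, ?_, i4.trans h1m, i5, i6.trans h1t, by rw [← h1m]; exact i3, fun s hs => (i7 s hs).trans (h1s s hs),
    i8.trans h1vi, i9.trans h1vo, ?_, ?_⟩
  · rw [e1, Nat.mod_eq_of_lt hpow]
  · rw [e3]; exact Nat.div_eq_of_lt hpow
  · refine i10.trans ?_
    rw [h1pk, h1m]
    refine max_le (max_le (le_max_left _ _) ?_) (le_max_right _ _)
    exact le_max_of_le_right (by nlinarith)
  · rw [h1st] at i11; omega

end PowMod

/-! ### Integer `k`-th roots by bisection -/

/-- One bisection round for `⌊x^{1/k}⌋` on the bracket `(lo, hi)`. [folklore] -/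
def bisStep (x k : ℕ) (p : ℕ × ℕ) : ℕ × ℕ :=
  if x < ((p.1 + p.2) / 2) ^ k then (p.1, (p.1 + p.2) / 2) else ((p.1 + p.2) / 2, p.2)

omit [DecidableEq S] [DecidableEq V] [DecidableEq O] in
/-- Bisection keeps the bracket `lo^k ≤ x < hi^k`, `lo < hi`. [folklore] -/
theorem bisStep_inv {x k : ℕ} {p : ℕ × ℕ} (h1 : p.1 ^ k ≤ x) (h2 : x < p.2 ^ k) (h3 : p.1 < p.2) :
    (bisStep x k p).1 ^ k ≤ x ∧ x < (bisStep x k p).2 ^ k ∧ (bisStep x k p).1 < (bisStep x k p).2 := by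
  unfold bisStep
  split_ifs with h
  · refine ⟨h1, h, ?_⟩
    simp only
    -- `lo < mid` unless `mid = lo`, which would give `x < lo^k ≤ x`
    by_contra hle
    have hmid : (p.1 + p.2) / 2 = p.1 := by omega
    rw [hmid] at h; omega
  · exact ⟨not_lt.1 h, h2, by simp only; omega⟩

omit [DecidableEq S] [DecidableEq V] [DecidableEq O] in
/-- Bisection halves the bracket, rounding up. [folklore] -/
theorem bisStep_gap (x k : ℕ) (p : ℕ × ℕ) (h3 : p.1 ≤ p.2) :
    (bisStep x k p).2 - (bisStep x k p).1 ≤ (p.2 - p.1 + 1) / 2 := by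
  unfold bisStep; split_ifs <;> simp only <;> omega

omit [DecidableEq S] [DecidableEq V] [DecidableEq O] in
/-- After `j` rounds the bracket has width at most `g₀ / 2^j + 1` (and the invariant holds).
[folklore] -/
theorem bisStep_iterate {x k : ℕ} {p : ℕ × ℕ} (h1 : p.1 ^ k ≤ x) (h2 : x < p.2 ^ k) (h3 : p.1 < p.2) :
    ∀ j, ((bisStep x k)^[j] p).1 ^ k ≤ x ∧ x < ((bisStep x k)^[j] p).2 ^ k ∧
      ((bisStep x k)^[j] p).1 < ((bisStep x k)^[j] p).2 ∧
      ((bisStep x k)^[j] p).2 - ((bisStep x k)^[j] p).1 ≤ (p.2 - p.1) / 2 ^ j + 1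
  | 0 => ⟨h1, h2, h3, by simp⟩
  | j + 1 => by
    obtain ⟨i1, i2, i3, i4⟩ := bisStep_iterate h1 h2 h3 j
    rw [Function.iterate_succ_apply']
    obtain ⟨s1, s2, s3⟩ := bisStep_inv i1 i2 i3
    refine ⟨s1, s2, s3, ?_⟩
    refine (bisStep_gap x k _ i3.le).trans ?_
    rw [pow_succ, ← Nat.div_div_eq_div_mul]
    omega

omit [DecidableEq S] [DecidableEq V] [DecidableEq O] in
/-- **Bisection finds the root**: from the bracket `(0, x + 1)`, after `n ≥ size (x + 1)` rounds
the bracket is `(r, r + 1)` with `r^k ≤ x < (r+1)^k` (`k ≥ 1`). [folklore] -/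
theorem bisStep_root {x k n : ℕ} (hk : 1 ≤ k) (hn : (x + 1).size ≤ n) :
    ((bisStep x k)^[n] (0, x + 1)).1 ^ k ≤ x ∧ x < (((bisStep x k)^[n] (0, x + 1)).1 + 1) ^ k := by
  have h2 : x < (x + 1) ^ k := by
    calc x < x + 1 := Nat.lt_succ_self x
      _ = (x + 1) ^ 1 := (pow_one _).symm
      _ ≤ (x + 1) ^ k := Nat.pow_le_pow_right (Nat.succ_pos x) hk
  obtain ⟨i1, i2, i3, i4⟩ := bisStep_iterate (p := (0, x + 1)) (by simp [Nat.zero_pow hk]) h2 (Nat.succ_pos x) n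
  have hz : (x + 1 - 0) / 2 ^ n = 0 :=
    Nat.div_eq_of_lt (Nat.lt_of_lt_of_le (Nat.lt_size_self _) (Nat.pow_le_pow_right (by norm_num) hn))
  rw [hz] at i4
  have heq : ((bisStep x k)^[n] (0, x + 1)).2 = ((bisStep x k)^[n] (0, x + 1)).1 + 1 := by omega
  rw [heq] at i2
  exact ⟨i1, i2⟩

/-- The roles of `irootP`: the argument `x`, the bracket `lo, hi`, the midpoint `mid`, the
power accumulator `acc`, a scratch `tmp`, the constant `two`, quotient scratch `q`, loop count
`t`. [folklore] -/
inductive RootR where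
  | x | lo | hi | mid | acc | tmp | two | q | t
  deriving DecidableEq, Fintype, Repr

section Root

variable (ρ : RootR ↪ S)

/-- `acc := acc · mid`, `n` times. [folklore] -/
def mulK : ℕ → NCom S V O E
  | 0 => skip
  | n + 1 => mul (ρ .acc) (ρ .acc) (ρ .mid) ;ₙ mulK n

/-- Effect of `mulK n`. [folklore] -/
theorem mulK_spec : ∀ (n : ℕ) (σ : NState S V O),
    let τ := (mulK ρ n : NCom S V O E).eval 𝓔 σ
    τ.sc (ρ .acc) = σ.sc (ρ .acc) * σ.sc (ρ .mid) ^ n ∧ (∀ s, s ≠ ρ .acc → τ.sc s = σ.sc s) ∧ τ.vi = σ.vi ∧ τ.vo = σ.vo ∧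
      τ.peak ≤ max σ.peak (max (σ.sc (ρ .acc)) (σ.sc (ρ .acc) * σ.sc (ρ .mid) ^ n)) ∧ τ.steps = σ.steps + n
  | 0, σ => ⟨by simp [mulK], fun _ _ => by simp [mulK], by simp [mulK], by simp [mulK], by simp [mulK], by simp [mulK]⟩
  | n + 1, σ => by
    intro τ
    set σ₁ := (mul (ρ .acc) (ρ .acc) (ρ .mid) : NCom S V O E).eval 𝓔 σ with hσ₁
    obtain ⟨i1, i2, i3, i4, i5, i6⟩ := mulK_spec n σ₁
    have hτ : τ = (mulK ρ n : NCom S V O E).eval 𝓔 σ₁ := rfl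
    have a1 : σ₁.sc (ρ .acc) = σ.sc (ρ .acc) * σ.sc (ρ .mid) := by simp [hσ₁, eval]
    have a2 : σ₁.sc (ρ .mid) = σ.sc (ρ .mid) := by simp [hσ₁, eval]
    have a3 : ∀ s, s ≠ ρ .acc → σ₁.sc s = σ.sc s := fun s hs => by simp [hσ₁, eval, hs]
    have a4 : σ₁.peak = max σ.peak (σ.sc (ρ .acc) * σ.sc (ρ .mid)) := by simp [hσ₁, eval]
    have a5 : σ₁.steps = σ.steps + 1 := by simp [hσ₁, eval]
    rw [hτ]
    refine ⟨by rw [i1, a1, a2, pow_succ']; ring, fun s hs => (i2 s hs).trans (a3 s hs), i3.trans (by simp [hσ₁, eval]),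
      i4.trans (by simp [hσ₁, eval]), ?_, by rw [i6, a5]; ring⟩
    refine i5.trans ?_
    rw [a4, a1, a2]
    -- all partial products are between `acc` and `acc * mid^(n+1)` (or zero)
    rcases Nat.eq_zero_or_pos (σ.sc (ρ .mid)) with hm | hm
    · simp [hm]
    · have hmono : ∀ i j, i ≤ j → σ.sc (ρ .acc) * σ.sc (ρ .mid) ^ i ≤ σ.sc (ρ .acc) * σ.sc (ρ .mid) ^ j :=
        fun i j hij => Nat.mul_le_mul_left _ (Nat.pow_le_pow_right hm hij)
      have h1 := hmono 1 (n + 1) (by omega)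
      have h2 := hmono 0 (n + 1) (by omega)
      rw [pow_one] at h1; rw [pow_zero, mul_one] at h2
      rw [mul_assoc, ← pow_succ']
      refine max_le (max_le (le_max_left _ _) (le_max_of_le_right (le_max_of_le_right h1))) ?_
      exact max_le (le_max_of_le_right (le_max_of_le_right h1)) (le_max_of_le_right (le_max_right _ _))

/-- The loop body of `irootP k`: `mid := (lo + hi) / 2`, `acc := mid^k`, then shrink the
bracket. [folklore] -/
def irootBody (k : ℕ) : NCom S V O E :=
  add (ρ .tmp) (ρ .lo) (ρ .hi) ;ₙ divmod (ρ .mid) (ρ .q) (ρ .tmp) (ρ .two) ;ₙ mov (ρ .acc) (ρ .mid) ;ₙ mulK ρ (k - 1) ;ₙ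
  ifLt (ρ .x) (ρ .acc) (mov (ρ .hi) (ρ .mid)) (mov (ρ .lo) (ρ .mid))

/-- **Integer `k`-th root** `lo := ⌊x^{1/k}⌋` by bisection of `(0, x + 1)` in `t ≥ size (x+1)`
rounds. [Knuth 1998, §4.5.4 (cf. exercise 41: bisection); folklore] [folklore] -/
def irootP (k : ℕ) : NCom S V O E :=
  setc (ρ .lo) 0 ;ₙ setc (ρ .two) 2 ;ₙ setc (ρ .tmp) 1 ;ₙ add (ρ .hi) (ρ .x) (ρ .tmp) ;ₙ times (ρ .t) (irootBody ρ k)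

omit [DecidableEq S] [DecidableEq V] [DecidableEq O] in
/-- `mulK n` has no extension calls. [folklore] -/
theorem mulK_noExt : ∀ n, (mulK ρ n : NCom S V O E).noExt
  | 0 => trivial
  | n + 1 => ⟨trivial, mulK_noExt n⟩

omit [DecidableEq S] [DecidableEq V] [DecidableEq O] in
/-- `irootP k` has no extension calls. [folklore] -/
theorem irootP_noExt (k : ℕ) : (irootP ρ k : NCom S V O E).noExt := by
  simp [irootP, irootBody, noExt, mulK_noExt]

/-- One round of `irootBody`. [folklore] -/
theorem irootBody_spec {k : ℕ} (hk : 1 ≤ k) (σ : NState S V O) (htwo : σ.sc (ρ .two) = 2)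
    (hlo : σ.sc (ρ .lo) ≤ σ.sc (ρ .x) + 1) (hhi : σ.sc (ρ .hi) ≤ σ.sc (ρ .x) + 1) :
    let τ := (irootBody ρ k : NCom S V O E).eval 𝓔 σ
    (τ.sc (ρ .lo), τ.sc (ρ .hi)) = bisStep (σ.sc (ρ .x)) k (σ.sc (ρ .lo), σ.sc (ρ .hi)) ∧
      τ.sc (ρ .x) = σ.sc (ρ .x) ∧ τ.sc (ρ .two) = 2 ∧ τ.sc (ρ .t) = σ.sc (ρ .t) ∧
      (∀ s, (∀ i, s ≠ ρ i) → τ.sc s = σ.sc s) ∧ τ.vi = σ.vi ∧ τ.vo = σ.vo ∧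
      τ.peak ≤ max σ.peak (2 * (σ.sc (ρ .x) + 1) ^ k) ∧ τ.steps ≤ σ.steps + k + 4 := by
  intro τ
  -- the state after the first three instructions
  set σ₃ := ((add (ρ .tmp) (ρ .lo) (ρ .hi) ;ₙ divmod (ρ .mid) (ρ .q) (ρ .tmp) (ρ .two) ;ₙ mov (ρ .acc) (ρ .mid) :
    NCom S V O E)).eval 𝓔 σ with hσ₃
  set md := (σ.sc (ρ .lo) + σ.sc (ρ .hi)) / 2 with hmd
  have b_acc : σ₃.sc (ρ .acc) = md := by simp [hσ₃, eval, htwo, hmd]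
  have b_mid : σ₃.sc (ρ .mid) = md := by simp [hσ₃, eval, htwo, hmd]
  have b_lo : σ₃.sc (ρ .lo) = σ.sc (ρ .lo) := by simp [hσ₃, eval]
  have b_hi : σ₃.sc (ρ .hi) = σ.sc (ρ .hi) := by simp [hσ₃, eval]
  have b_x : σ₃.sc (ρ .x) = σ.sc (ρ .x) := by simp [hσ₃, eval]
  have b_two : σ₃.sc (ρ .two) = 2 := by simp [hσ₃, eval, htwo]
  have b_t : σ₃.sc (ρ .t) = σ.sc (ρ .t) := by simp [hσ₃, eval]
  have b_s : ∀ s, (∀ i, s ≠ ρ i) → σ₃.sc s = σ.sc s := fun s hs => by simp [hσ₃, eval, hs]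
  have b_vi : σ₃.vi = σ.vi := by simp [hσ₃, eval]
  have b_vo : σ₃.vo = σ.vo := by simp [hσ₃, eval]
  have b_pk : σ₃.peak = max σ.peak (σ.sc (ρ .lo) + σ.sc (ρ .hi)) := by simp [hσ₃, eval]
  have b_st : σ₃.steps = σ.steps + 3 := by simp [hσ₃, eval]
  -- the powering
  set σ₄ := (mulK ρ (k - 1) : NCom S V O E).eval 𝓔 σ₃ with hσ₄
  obtain ⟨c1, c2, c3, c4, c5, c6⟩ := mulK_spec 𝓔 ρ (k - 1) σ₃
  rw [← hσ₄] at c1 c2 c3 c4 c5 c6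
  rw [b_acc, b_mid, ← pow_succ', Nat.sub_add_cancel hk] at c1
  have hτ : τ = (ifLt (ρ .x) (ρ .acc) (mov (ρ .hi) (ρ .mid)) (mov (ρ .lo) (ρ .mid)) : NCom S V O E).eval 𝓔 σ₄ := rfl
  have hmdle : md ≤ σ.sc (ρ .x) + 1 := by omega
  have hpowle : md ^ k ≤ (σ.sc (ρ .x) + 1) ^ k := Nat.pow_le_pow_left hmdle k
  have hpk4 : σ₄.peak ≤ max σ.peak (2 * (σ.sc (ρ .x) + 1) ^ k) := by
    refine c5.trans ?_
    rw [b_pk, b_acc, b_mid, ← pow_succ', Nat.sub_add_cancel hk]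
    have h1 : (σ.sc (ρ .x) + 1) ^ 1 ≤ (σ.sc (ρ .x) + 1) ^ k := Nat.pow_le_pow_right (Nat.succ_pos _) hk
    rw [pow_one] at h1
    refine max_le (max_le (le_max_left _ _) (le_max_of_le_right (by omega))) (le_max_of_le_right (max_le ?_ ?_)) <;>
      omega
  have c_x : σ₄.sc (ρ .x) = σ.sc (ρ .x) := (c2 _ (by simp)).trans b_x
  have c_mid : σ₄.sc (ρ .mid) = md := (c2 _ (by simp)).trans b_mid
  have c_lo : σ₄.sc (ρ .lo) = σ.sc (ρ .lo) := (c2 _ (by simp)).trans b_lo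
  have c_hi : σ₄.sc (ρ .hi) = σ.sc (ρ .hi) := (c2 _ (by simp)).trans b_hi
  have c_two : σ₄.sc (ρ .two) = 2 := (c2 _ (by simp)).trans b_two
  have c_t : σ₄.sc (ρ .t) = σ.sc (ρ .t) := (c2 _ (by simp)).trans b_t
  by_cases hlt : σ.sc (ρ .x) < md ^ k
  · have hτ' : τ = (mov (ρ .hi) (ρ .mid) : NCom S V O E).eval 𝓔 (σ₄.bump 0 1) := by
      rw [hτ]; exact eval_ifLt_lt 𝓔 _ _ (by rw [c_x, c1]; exact hlt)
    have hbs : bisStep (σ.sc (ρ .x)) k (σ.sc (ρ .lo), σ.sc (ρ .hi)) = (σ.sc (ρ .lo), md) := if_pos hlt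
    rw [hbs]
    refine ⟨?_, ?_, ?_, ?_, fun s hs => ?_, ?_, ?_, ?_, ?_⟩
    · simp [hτ', eval, c_lo, c_mid]
    · simp [hτ', eval, c_x]
    · simp [hτ', eval, c_two]
    · simp [hτ', eval, c_t]
    · simp only [hτ', eval, NState.sc_bump, NState.sc_setSc]
      rw [Function.update_of_ne (hs _)]; exact (c2 s (hs _)).trans (b_s s hs)
    · simp [hτ', eval, c3, b_vi]
    · simp [hτ', eval, c4, b_vo]
    · simp only [hτ', eval, NState.peak_bump, NState.peak_setSc, Nat.max_zero]; exact hpk4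
    · simp only [hτ', eval, NState.steps_bump, NState.steps_setSc]; omega
  · have hτ' : τ = (mov (ρ .lo) (ρ .mid) : NCom S V O E).eval 𝓔 (σ₄.bump 0 1) := by
      rw [hτ]; exact eval_ifLt_ge 𝓔 _ _ (by rw [c_x, c1]; exact not_lt.1 hlt)
    have hbs : bisStep (σ.sc (ρ .x)) k (σ.sc (ρ .lo), σ.sc (ρ .hi)) = (md, σ.sc (ρ .hi)) := if_neg hlt
    rw [hbs]
    refine ⟨?_, ?_, ?_, ?_, fun s hs => ?_, ?_, ?_, ?_, ?_⟩
    · simp [hτ', eval, c_hi, c_mid]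
    · simp [hτ', eval, c_x]
    · simp [hτ', eval, c_two]
    · simp [hτ', eval, c_t]
    · simp only [hτ', eval, NState.sc_bump, NState.sc_setSc]
      rw [Function.update_of_ne (hs _)]; exact (c2 s (hs _)).trans (b_s s hs)
    · simp [hτ', eval, c3, b_vi]
    · simp [hτ', eval, c4, b_vo]
    · simp only [hτ', eval, NState.peak_bump, NState.peak_setSc, Nat.max_zero]; exact hpk4
    · simp only [hτ', eval, NState.steps_bump, NState.steps_setSc]; omega

/-- `j` rounds of `irootBody`. [folklore] -/
theorem irootBody_iterate {k : ℕ} (hk : 1 ≤ k) (σ : NState S V O) (htwo : σ.sc (ρ .two) = 2)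
    (hlo : σ.sc (ρ .lo) ≤ σ.sc (ρ .x) + 1) (hhi : σ.sc (ρ .hi) ≤ σ.sc (ρ .x) + 1) (hlh : σ.sc (ρ .lo) ≤ σ.sc (ρ .hi)) :
    ∀ j, let υ := ((irootBody ρ k : NCom S V O E).eval 𝓔)^[j] σ
      (υ.sc (ρ .lo), υ.sc (ρ .hi)) = (bisStep (σ.sc (ρ .x)) k)^[j] (σ.sc (ρ .lo), σ.sc (ρ .hi)) ∧
        υ.sc (ρ .lo) ≤ σ.sc (ρ .x) + 1 ∧ υ.sc (ρ .hi) ≤ σ.sc (ρ .x) + 1 ∧ υ.sc (ρ .lo) ≤ υ.sc (ρ .hi) ∧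
        υ.sc (ρ .x) = σ.sc (ρ .x) ∧ υ.sc (ρ .two) = 2 ∧ υ.sc (ρ .t) = σ.sc (ρ .t) ∧
        (∀ s, (∀ i, s ≠ ρ i) → υ.sc s = σ.sc s) ∧ υ.vi = σ.vi ∧ υ.vo = σ.vo ∧
        υ.peak ≤ max σ.peak (2 * (σ.sc (ρ .x) + 1) ^ k) ∧ υ.steps ≤ σ.steps + (k + 4) * j
  | 0 => ⟨rfl, hlo, hhi, hlh, rfl, htwo, rfl, fun _ _ => rfl, rfl, rfl, le_max_left _ _, by simp⟩
  | j + 1 => by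
    obtain ⟨h1, h2, h3, h4, h5, h6, h7, h8, h9, h10, h11, h12⟩ := irootBody_iterate hk σ htwo hlo hhi hlh j
    intro υ
    set υ₀ := ((irootBody ρ k : NCom S V O E).eval 𝓔)^[j] σ with hυ₀
    have hυ : υ = (irootBody ρ k : NCom S V O E).eval 𝓔 υ₀ := Function.iterate_succ_apply' _ _ _
    rw [← h5] at h2 h3
    obtain ⟨r1, r2, r3, r4, r5, r6, r7, r8, r9⟩ := irootBody_spec 𝓔 ρ hk υ₀ h6 h2 h3
    rw [h5] at r1 r2 r8 h2 h3
    -- the new bracket stays within `[0, x+1]` and ordered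
    have hb : (bisStep (σ.sc (ρ .x)) k (υ₀.sc (ρ .lo), υ₀.sc (ρ .hi))).1 ≤ σ.sc (ρ .x) + 1 ∧
        (bisStep (σ.sc (ρ .x)) k (υ₀.sc (ρ .lo), υ₀.sc (ρ .hi))).2 ≤ σ.sc (ρ .x) + 1 ∧
        (bisStep (σ.sc (ρ .x)) k (υ₀.sc (ρ .lo), υ₀.sc (ρ .hi))).1 ≤ (bisStep (σ.sc (ρ .x)) k (υ₀.sc (ρ .lo), υ₀.sc (ρ .hi))).2 := by
      unfold bisStep; split_ifs <;> simp only <;> omega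
    rw [← r1] at hb
    rw [hυ, Function.iterate_succ_apply', ← h1]
    exact ⟨r1, hb.1, hb.2.1, hb.2.2, r2, r3, r4.trans h7, fun s hs => (r5 s hs).trans (h8 s hs), r6.trans h9, r7.trans h10,
      r8.trans (max_le h11 (le_max_right _ _)), by rw [Nat.mul_succ]; omega⟩

/-- **Specification of `irootP k`** (`k ≥ 1`).  With `t ≥ size (x + 1)` rounds the register
`lo` holds `r = ⌊x^{1/k}⌋`, characterised by `r^k ≤ x < (r+1)^k`; `hi = r + 1`, `two = 2`, the
scratch arbitrary, every other register unchanged, `peak ≤ max peak (2 (x+1)^k)`,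
`steps ≤ steps + (k + 5) t + 5`. [Knuth 1998, §4.5.4; folklore] [folklore] -/
theorem irootP_spec {k : ℕ} (hk : 1 ≤ k) (σ : NState S V O) (ht : (σ.sc (ρ .x) + 1).size ≤ σ.sc (ρ .t)) :
    let τ := (irootP ρ k : NCom S V O E).eval 𝓔 σ
    τ.sc (ρ .lo) ^ k ≤ σ.sc (ρ .x) ∧ σ.sc (ρ .x) < (τ.sc (ρ .lo) + 1) ^ k ∧ τ.sc (ρ .hi) = τ.sc (ρ .lo) + 1 ∧
      τ.sc (ρ .x) = σ.sc (ρ .x) ∧ τ.sc (ρ .two) = 2 ∧ τ.sc (ρ .t) = σ.sc (ρ .t) ∧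
      (∀ s, (∀ i, s ≠ ρ i) → τ.sc s = σ.sc s) ∧ τ.vi = σ.vi ∧ τ.vo = σ.vo ∧
      τ.peak ≤ max σ.peak (2 * (σ.sc (ρ .x) + 1) ^ k) ∧ τ.steps ≤ σ.steps + (k + 5) * σ.sc (ρ .t) + 5 := by
  intro τ
  set σ₀ := ((add (ρ .hi) (ρ .x) (ρ .tmp) : NCom S V O E)).eval 𝓔 (((setc (ρ .tmp) 1 : NCom S V O E)).eval 𝓔
    (((setc (ρ .two) 2 : NCom S V O E)).eval 𝓔 (((setc (ρ .lo) 0 : NCom S V O E)).eval 𝓔 σ))) with hσ₀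
  set σ₁ := σ₀.bump 0 (σ.sc (ρ .t) + 1) with hσ₁
  have hσt : σ₀.sc (ρ .t) = σ.sc (ρ .t) := by simp [hσ₀, eval]
  have hτ : τ = ((irootBody ρ k : NCom S V O E).eval 𝓔)^[σ.sc (ρ .t)] σ₁ := by
    show ((_ ;ₙ _ ;ₙ _ ;ₙ _ ;ₙ times _ _ : NCom S V O E)).eval 𝓔 σ = _
    rw [eval_seq, eval_seq, eval_seq, eval_seq, eval_times, ← hσ₀, hσt]
  have h1lo : σ₁.sc (ρ .lo) = 0 := by simp [hσ₁, hσ₀, eval]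
  have h1hi : σ₁.sc (ρ .hi) = σ.sc (ρ .x) + 1 := by simp [hσ₁, hσ₀, eval]
  have h1two : σ₁.sc (ρ .two) = 2 := by simp [hσ₁, hσ₀, eval]
  have h1x : σ₁.sc (ρ .x) = σ.sc (ρ .x) := by simp [hσ₁, hσ₀, eval]
  have h1t : σ₁.sc (ρ .t) = σ.sc (ρ .t) := by simp [hσ₁, hσ₀, eval]
  have h1s : ∀ s, (∀ i, s ≠ ρ i) → σ₁.sc s = σ.sc s := fun s hs => by simp [hσ₁, hσ₀, eval, hs]
  have h1vi : σ₁.vi = σ.vi := by simp [hσ₁, hσ₀, eval]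
  have h1vo : σ₁.vo = σ.vo := by simp [hσ₁, hσ₀, eval]
  have h1pk : σ₁.peak ≤ max σ.peak (2 * (σ.sc (ρ .x) + 1) ^ k) := by
    have h1 : (σ.sc (ρ .x) + 1) ^ 1 ≤ (σ.sc (ρ .x) + 1) ^ k := Nat.pow_le_pow_right (Nat.succ_pos _) hk
    rw [pow_one] at h1
    have e : σ₁.peak = max (max (max σ.peak 2) 1) (σ.sc (ρ .x) + 1) := by simp [hσ₁, hσ₀, eval]
    rw [e]
    refine max_le (max_le (max_le (le_max_left _ _) ?_) ?_) ?_ <;> exact le_max_of_le_right (by omega)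
  have h1st : σ₁.steps = σ.steps + 4 + (σ.sc (ρ .t) + 1) := by simp [hσ₁, hσ₀, eval]
  obtain ⟨i1, i2, i3, i4, i5, i6, i7, i8, i9, i10, i11, i12⟩ :=
    irootBody_iterate 𝓔 ρ hk σ₁ h1two (by rw [h1lo]; exact Nat.zero_le _) (by rw [h1hi, h1x]) (by rw [h1lo]; exact Nat.zero_le _)
      (σ.sc (ρ .t))
  rw [h1lo, h1hi, h1x] at i1
  rw [← hτ] at i1 i2 i3 i4 i5 i6 i7 i8 i9 i10 i11 i12
  obtain ⟨b1, b2⟩ := bisStep_root (x := σ.sc (ρ .x)) hk ht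
  obtain ⟨j1, j2, j3, j4⟩ := bisStep_iterate (x := σ.sc (ρ .x)) (k := k) (p := (0, σ.sc (ρ .x) + 1)) (by simp [Nat.zero_pow hk])
    (lt_of_lt_of_le (Nat.lt_succ_self _) (by
      calc σ.sc (ρ .x) + 1 = (σ.sc (ρ .x) + 1) ^ 1 := (pow_one _).symm
        _ ≤ (σ.sc (ρ .x) + 1) ^ k := Nat.pow_le_pow_right (Nat.succ_pos _) hk)) (Nat.succ_pos _) (σ.sc (ρ .t))
  have hz : (σ.sc (ρ .x) + 1 - 0) / 2 ^ σ.sc (ρ .t) = 0 :=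
    Nat.div_eq_of_lt (Nat.lt_of_lt_of_le (Nat.lt_size_self _) (Nat.pow_le_pow_right (by norm_num) ht))
  rw [hz] at j4
  have elo : τ.sc (ρ .lo) = ((bisStep (σ.sc (ρ .x)) k)^[σ.sc (ρ .t)] (0, σ.sc (ρ .x) + 1)).1 := (Prod.mk.inj i1).1
  have ehi : τ.sc (ρ .hi) = ((bisStep (σ.sc (ρ .x)) k)^[σ.sc (ρ .t)] (0, σ.sc (ρ .x) + 1)).2 := (Prod.mk.inj i1).2
  refine ⟨by rw [elo]; exact b1, by rw [elo]; exact b2, by rw [elo, ehi]; omega, i5.trans h1x, i6, i7.trans h1t,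
    fun s hs => (i8 s hs).trans (h1s s hs), i9.trans h1vi, i10.trans h1vo, ?_, ?_⟩
  · refine i11.trans ?_
    rw [h1x]
    exact max_le h1pk (le_max_right _ _)
  · rw [h1st] at i12
    nlinarith

end Root

/-! ### Queue utilities: moving a prefix, emitting constants -/

section Queues

/-- `moveN v o x cnt`: move the first `cnt` entries of the queue `v` to the back of the
accumulator `o` (through the scalar `x`). [folklore] -/
def moveN (v : V) (o : O) (x cnt : S) : NCom S V O E := times cnt (pop v x ;ₙ emit o x)

/-- `emitK o x cnt`: emit the scalar `x` to `o`, `cnt` times. [folklore] -/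
def emitK (o : O) (x cnt : S) : NCom S V O E := times cnt (emit o x)

omit [DecidableEq S] [DecidableEq V] [DecidableEq O] in
/-- `moveN` has no extension calls. [folklore] -/
theorem moveN_noExt (v : V) (o : O) (x cnt : S) : (moveN v o x cnt : NCom S V O E).noExt := by simp [moveN, noExt]

omit [DecidableEq S] [DecidableEq V] [DecidableEq O] in
/-- `emitK` has no extension calls. [folklore] -/
theorem emitK_noExt (o : O) (x cnt : S) : (emitK o x cnt : NCom S V O E).noExt := by simp [emitK, noExt]

/-- Rounds of `moveN`. [folklore] -/
theorem moveN_iterate (v : V) (o : O) (x : S) (σ : NState S V O) :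
    ∀ j, j ≤ (σ.vi v).length → let υ := ((pop v x ;ₙ emit o x : NCom S V O E).eval 𝓔)^[j] σ
      υ.vi v = (σ.vi v).drop j ∧ υ.vo o = σ.vo o ++ (σ.vi v).take j ∧ (∀ s, s ≠ x → υ.sc s = σ.sc s) ∧
        (∀ w, w ≠ v → υ.vi w = σ.vi w) ∧ (∀ p, p ≠ o → υ.vo p = σ.vo p) ∧ υ.peak = σ.peak ∧ υ.steps = σ.steps + 2 * j
  | 0, _ => ⟨rfl, by simp, fun _ _ => rfl, fun _ _ => rfl, fun _ _ => rfl, rfl, rfl⟩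
  | j + 1, hj => by
    obtain ⟨h1, h2, h3, h4, h5, h6, h7⟩ := moveN_iterate v o x σ j (Nat.le_of_succ_le hj)
    intro υ
    set υ₀ := ((pop v x ;ₙ emit o x : NCom S V O E).eval 𝓔)^[j] σ with hυ₀
    have hυ : υ = (pop v x ;ₙ emit o x : NCom S V O E).eval 𝓔 υ₀ := Function.iterate_succ_apply' _ _ _
    have hne : (σ.vi v).drop j ≠ [] := by
      rw [Ne, List.drop_eq_nil_iff]; omega
    obtain ⟨a, l, hal⟩ : ∃ a l, (σ.vi v).drop j = a :: l := List.exists_cons_of_ne_nil hne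
    have hhead : υ₀.vi v = a :: l := h1.trans hal
    have hx : a = (σ.vi v)[j]'(by omega) := by
      have := List.drop_eq_getElem_cons (l := σ.vi v) (i := j) (by omega)
      rw [this] at hal; exact (List.cons.inj hal).1.symm
    rw [hυ]
    refine ⟨?_, ?_, fun s hs => ?_, fun w hw => ?_, fun p hp => ?_, ?_, ?_⟩
    · simp only [eval, NState.vi_bump, NState.vi_setVo, NState.vi_setVi, NState.vi_setSc, Function.update_self,
        hhead, List.tail_cons]
      rw [← List.drop_drop, hal]; rfl
    · simp only [eval, NState.vo_bump, NState.vo_setVo, NState.sc_setVi, NState.sc_bump, NState.sc_setSc,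
        Function.update_self, hhead, List.headD_cons, NState.vo_setVi, NState.vo_setSc, h2, List.append_assoc]
      rw [hx, List.take_succ_eq_append_getElem (by omega)]
    · simp [eval, hs, h3 s hs]
    · simp [eval, hw, h4 w hw]
    · simp [eval, hp, h5 p hp]
    · simp [eval, h6]
    · simp [eval, h7]; ring

/-- **Specification of `moveN`** (`cnt ≤ |v|`): `v` loses its first `cnt` entries, `o` gains
them, only `x` changes among scalars, `peak` unchanged, `steps = steps + 3 cnt + 1`. [folklore] -/
theorem moveN_spec (v : V) (o : O) (x cnt : S) (σ : NState S V O) (h : σ.sc cnt ≤ (σ.vi v).length) :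
    let τ := (moveN v o x cnt : NCom S V O E).eval 𝓔 σ
    τ.vi v = (σ.vi v).drop (σ.sc cnt) ∧ τ.vo o = σ.vo o ++ (σ.vi v).take (σ.sc cnt) ∧
      (∀ s, s ≠ x → τ.sc s = σ.sc s) ∧ (∀ w, w ≠ v → τ.vi w = σ.vi w) ∧ (∀ p, p ≠ o → τ.vo p = σ.vo p) ∧
      τ.peak = σ.peak ∧ τ.steps = σ.steps + 3 * σ.sc cnt + 1 := by
  intro τ
  obtain ⟨h1, h2, h3, h4, h5, h6, h7⟩ := moveN_iterate 𝓔 v o x (σ.bump 0 (σ.sc cnt + 1)) (σ.sc cnt) (by simpa using h)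
  simp only [NState.vi_bump, NState.vo_bump, NState.sc_bump, NState.peak_bump, NState.steps_bump, Nat.max_zero] at h1 h2 h3 h4 h5 h6 h7
  exact ⟨h1, h2, h3, h4, h5, h6, by rw [show τ.steps = _ from h7]; ring⟩

/-- **Specification of `emitK`**: `o` gains `cnt` copies of `x`; nothing else changes;
`steps = steps + 2 cnt + 1`. [folklore] -/
theorem emitK_spec (o : O) (x cnt : S) (σ : NState S V O) :
    let τ := (emitK o x cnt : NCom S V O E).eval 𝓔 σ
    τ.vo o = σ.vo o ++ List.replicate (σ.sc cnt) (σ.sc x) ∧ τ.sc = σ.sc ∧ τ.vi = σ.vi ∧ (∀ p, p ≠ o → τ.vo p = σ.vo p) ∧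
      τ.peak = σ.peak ∧ τ.steps = σ.steps + 2 * σ.sc cnt + 1 := by
  intro τ
  have key : ∀ j, let υ := ((emit o x : NCom S V O E).eval 𝓔)^[j] (σ.bump 0 (σ.sc cnt + 1))
      υ.vo o = σ.vo o ++ List.replicate j (σ.sc x) ∧ υ.sc = σ.sc ∧ υ.vi = σ.vi ∧ (∀ p, p ≠ o → υ.vo p = σ.vo p) ∧
        υ.peak = σ.peak ∧ υ.steps = σ.steps + (σ.sc cnt + 1) + j := by
    intro j
    induction j with
    | zero => simp
    | succ j ih =>
      obtain ⟨i1, i2, i3, i4, i5, i6⟩ := ih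
      intro υ
      set υ₀ := ((emit o x : NCom S V O E).eval 𝓔)^[j] (σ.bump 0 (σ.sc cnt + 1)) with hυ₀
      have hυ : υ = (emit o x : NCom S V O E).eval 𝓔 υ₀ := Function.iterate_succ_apply' _ _ _
      rw [hυ]
      refine ⟨?_, ?_, ?_, fun p hp => ?_, ?_, ?_⟩
      · simp [eval, i1, i2, List.replicate_succ']
      · simp [eval, i2]
      · simp [eval, i3]
      · simp [eval, hp, i4 p hp]
      · simp [eval, i5]
      · simp [eval, i6]; ring
  obtain ⟨k1, k2, k3, k4, k5, k6⟩ := key (σ.sc cnt)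
  exact ⟨k1, k2, k3, k4, k5, by rw [show τ.steps = _ from k6]; ring⟩

/-- **`moveN` in closed form** (`cnt ≤ |v|`). [folklore] -/
theorem moveN_eq (v : V) (o : O) (x cnt : S) (σ : NState S V O) (h : σ.sc cnt ≤ (σ.vi v).length) :
    ∃ xv, (moveN v o x cnt : NCom S V O E).eval 𝓔 σ =
      { sc := Function.update σ.sc x xv, vi := Function.update σ.vi v ((σ.vi v).drop (σ.sc cnt)),
        vo := Function.update σ.vo o (σ.vo o ++ (σ.vi v).take (σ.sc cnt)), peak := σ.peak,
        steps := σ.steps + 3 * σ.sc cnt + 1 } := by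
  obtain ⟨h1, h2, h3, h4, h5, h6, h7⟩ := moveN_spec 𝓔 v o x cnt σ h
  refine ⟨((moveN v o x cnt : NCom S V O E).eval 𝓔 σ).sc x, NState.ext ?_ ?_ ?_ h6 h7⟩
  · funext s; by_cases hs : s = x
    · subst hs; simp
    · show _ = Function.update σ.sc x _ s; rw [Function.update_of_ne hs]; exact h3 s hs
  · funext w; by_cases hw : w = v
    · subst hw; simpa using h1
    · show _ = Function.update σ.vi v _ w; rw [Function.update_of_ne hw]; exact h4 w hw
  · funext p; by_cases hp : p = o
    · subst hp; simpa using h2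
    · show _ = Function.update σ.vo o _ p; rw [Function.update_of_ne hp]; exact h5 p hp

/-- The final value of the transfer scalar of `moveN` (a canonical witness for `moveN_eq`).
[folklore] -/
def moveNx (v : V) (o : O) (x cnt : S) (σ : NState S V O) : ℕ := ((moveN v o x cnt : NCom S V O E).eval 𝓔 σ).sc x

/-- **`moveN` in closed form**, as a rewrite rule (`cnt ≤ |v|`). [folklore] -/
theorem moveN_eq' (v : V) (o : O) (x cnt : S) (σ : NState S V O) (h : σ.sc cnt ≤ (σ.vi v).length) :
    (moveN v o x cnt : NCom S V O E).eval 𝓔 σ =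
      { sc := Function.update σ.sc x (moveNx 𝓔 v o x cnt σ), vi := Function.update σ.vi v ((σ.vi v).drop (σ.sc cnt)),
        vo := Function.update σ.vo o (σ.vo o ++ (σ.vi v).take (σ.sc cnt)), peak := σ.peak,
        steps := σ.steps + 3 * σ.sc cnt + 1 } := by
  obtain ⟨xv, e⟩ := moveN_eq 𝓔 v o x cnt σ h
  have hx : moveNx 𝓔 v o x cnt σ = xv := by unfold moveNx; rw [e]; simp
  rw [hx]; exact e

/-- **`emitK` in closed form.** [folklore] -/
theorem emitK_eq (o : O) (x cnt : S) (σ : NState S V O) :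
    (emitK o x cnt : NCom S V O E).eval 𝓔 σ =
      { σ with vo := Function.update σ.vo o (σ.vo o ++ List.replicate (σ.sc cnt) (σ.sc x)),
               steps := σ.steps + 2 * σ.sc cnt + 1 } := by
  obtain ⟨h1, h2, h3, h4, h5, h6⟩ := emitK_spec 𝓔 o x cnt σ
  refine NState.ext h2 h3 ?_ h5 h6
  funext p; by_cases hp : p = o
  · subst hp; simpa using h1
  · show _ = Function.update σ.vo o _ p; rw [Function.update_of_ne hp]; exact h4 p hp

end Queues

/-! ### Moving a prefix to two accumulators at once -/

section Tee

/-- `teeN v o₁ o₂ x cnt`: move the first `cnt` entries of the queue `v` to the back of both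
accumulators `o₁` and `o₂`. [folklore] -/
def teeN (v : V) (o₁ o₂ : O) (x cnt : S) : NCom S V O E := times cnt (pop v x ;ₙ emit o₁ x ;ₙ emit o₂ x)

omit [DecidableEq S] [DecidableEq V] [DecidableEq O] in
/-- `teeN` has no extension calls. [folklore] -/
theorem teeN_noExt (v : V) (o₁ o₂ : O) (x cnt : S) : (teeN v o₁ o₂ x cnt : NCom S V O E).noExt := by simp [teeN, noExt]

/-- Rounds of `teeN` (`o₁ ≠ o₂`). [folklore] -/
theorem teeN_iterate (v : V) {o₁ o₂ : O} (ho : o₁ ≠ o₂) (x : S) (σ : NState S V O) :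
    ∀ j, j ≤ (σ.vi v).length → let υ := ((pop v x ;ₙ emit o₁ x ;ₙ emit o₂ x : NCom S V O E).eval 𝓔)^[j] σ
      υ.vi v = (σ.vi v).drop j ∧ υ.vo o₁ = σ.vo o₁ ++ (σ.vi v).take j ∧ υ.vo o₂ = σ.vo o₂ ++ (σ.vi v).take j ∧
        (∀ s, s ≠ x → υ.sc s = σ.sc s) ∧ (∀ w, w ≠ v → υ.vi w = σ.vi w) ∧ (∀ p, p ≠ o₁ → p ≠ o₂ → υ.vo p = σ.vo p) ∧
        υ.peak = σ.peak ∧ υ.steps = σ.steps + 3 * j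
  | 0, _ => ⟨rfl, by simp, by simp, fun _ _ => rfl, fun _ _ => rfl, fun _ _ _ => rfl, rfl, rfl⟩
  | j + 1, hj => by
    obtain ⟨h1, h2, h3, h4, h5, h6, h7, h8⟩ := teeN_iterate v ho x σ j (Nat.le_of_succ_le hj)
    intro υ
    set υ₀ := ((pop v x ;ₙ emit o₁ x ;ₙ emit o₂ x : NCom S V O E).eval 𝓔)^[j] σ with hυ₀
    have hυ : υ = (pop v x ;ₙ emit o₁ x ;ₙ emit o₂ x : NCom S V O E).eval 𝓔 υ₀ := Function.iterate_succ_apply' _ _ _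
    have hne : (σ.vi v).drop j ≠ [] := by rw [Ne, List.drop_eq_nil_iff]; omega
    obtain ⟨a, l, hal⟩ : ∃ a l, (σ.vi v).drop j = a :: l := List.exists_cons_of_ne_nil hne
    have hhead : υ₀.vi v = a :: l := h1.trans hal
    have hx : a = (σ.vi v)[j]'(by omega) := by
      have := List.drop_eq_getElem_cons (l := σ.vi v) (i := j) (by omega)
      rw [this] at hal; exact (List.cons.inj hal).1.symm
    rw [hυ]
    refine ⟨?_, ?_, ?_, fun s hs => ?_, fun w hw => ?_, fun p hp₁ hp₂ => ?_, ?_, ?_⟩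
    · simp only [eval, NState.vi_bump, NState.vi_setVo, NState.vi_setVi, NState.vi_setSc, Function.update_self, hhead,
        List.tail_cons]
      rw [← List.drop_drop, hal]; rfl
    · simp only [eval, NState.vo_bump, NState.vo_setVo, NState.sc_setVi, NState.sc_bump, NState.sc_setSc, NState.sc_setVo,
        Function.update_self, hhead, List.headD_cons, NState.vo_setVi, NState.vo_setSc, h2, List.append_assoc,
        Function.update_of_ne ho]
      rw [hx, List.take_succ_eq_append_getElem (by omega)]
    · simp only [eval, NState.vo_bump, NState.vo_setVo, NState.sc_setVi, NState.sc_bump, NState.sc_setSc, NState.sc_setVo,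
        Function.update_self, hhead, List.headD_cons, NState.vo_setVi, NState.vo_setSc, h3, List.append_assoc,
        Function.update_of_ne ho.symm]
      rw [hx, List.take_succ_eq_append_getElem (by omega)]
    · simp [eval, hs, h4 s hs]
    · simp [eval, hw, h5 w hw]
    · simp [eval, hp₁, hp₂, h6 p hp₁ hp₂]
    · simp [eval, h7]
    · simp [eval, h8]; ring

/-- The final value of the transfer scalar of `teeN` (canonical witness). [folklore] -/
def teeNx (v : V) (o₁ o₂ : O) (x cnt : S) (σ : NState S V O) : ℕ := ((teeN v o₁ o₂ x cnt : NCom S V O E).eval 𝓔 σ).sc x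

/-- **`teeN` in closed form** (`cnt ≤ |v|`, `o₁ ≠ o₂`). [folklore] -/
theorem teeN_eq (v : V) {o₁ o₂ : O} (ho : o₁ ≠ o₂) (x cnt : S) (σ : NState S V O) (h : σ.sc cnt ≤ (σ.vi v).length) :
    (teeN v o₁ o₂ x cnt : NCom S V O E).eval 𝓔 σ =
      { sc := Function.update σ.sc x (teeNx 𝓔 v o₁ o₂ x cnt σ), vi := Function.update σ.vi v ((σ.vi v).drop (σ.sc cnt)),
        vo := Function.update (Function.update σ.vo o₁ (σ.vo o₁ ++ (σ.vi v).take (σ.sc cnt))) o₂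
          (σ.vo o₂ ++ (σ.vi v).take (σ.sc cnt)),
        peak := σ.peak, steps := σ.steps + 4 * σ.sc cnt + 1 } := by
  obtain ⟨h1, h2, h3, h4, h5, h6, h7, h8⟩ := teeN_iterate 𝓔 v ho x (σ.bump 0 (σ.sc cnt + 1)) (σ.sc cnt) (by simpa using h)
  simp only [NState.vi_bump, NState.vo_bump, NState.sc_bump, NState.peak_bump, NState.steps_bump, Nat.max_zero] at h1 h2 h3 h4 h5 h6 h7 h8
  unfold teeNx teeN
  rw [eval_times]
  refine NState.ext ?_ ?_ ?_ h7 (by rw [h8]; ring)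
  · funext s; by_cases hs : s = x
    · subst hs; simp
    · show _ = Function.update σ.sc x _ s; rw [Function.update_of_ne hs]; exact h4 s hs
  · funext w; by_cases hw : w = v
    · subst hw; simpa using h1
    · show _ = Function.update σ.vi v _ w; rw [Function.update_of_ne hw]; exact h5 w hw
  · funext p; by_cases hp₂ : p = o₂
    · subst hp₂; simpa using h3
    · show _ = Function.update (Function.update σ.vo o₁ _) o₂ _ p
      rw [Function.update_of_ne hp₂]
      by_cases hp₁ : p = o₁
      · subst hp₁; simpa using h2
      · rw [Function.update_of_ne hp₁]; exact h6 p hp₁ hp₂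

end Tee

/-! ### The least power of two above a scalar -/

section Pow2

/-- The doubling map of the loop computing a power of two `≥ s`. [folklore] -/
def dblF (s L : ℕ) : ℕ := if L < s then L + L else L

omit [DecidableEq S] [DecidableEq V] [DecidableEq O] in
/-- Rounds of the doubling loop from `L = 1`: a power of two, `< 2 s` (for `s ≥ 1`), and
`≥ s` or equal to `2^j`. [folklore] -/
theorem dbl_iterate (s : ℕ) (hs : 1 ≤ s) :
    ∀ j, (∃ k, (dblF s)^[j] 1 = 2 ^ k) ∧ (dblF s)^[j] 1 < 2 * s ∧ (s ≤ (dblF s)^[j] 1 ∨ (dblF s)^[j] 1 = 2 ^ j)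
  | 0 => ⟨⟨0, rfl⟩, by simp; omega, Or.inr rfl⟩
  | j + 1 => by
    obtain ⟨⟨k, hk⟩, h2, h3⟩ := dbl_iterate s hs j
    rw [Function.iterate_succ_apply', hk, dblF]
    rw [hk] at h2 h3
    split_ifs with h
    · refine ⟨⟨k + 1, by rw [pow_succ]; ring⟩, by omega, ?_⟩
      rcases h3 with h3 | h3
      · exact Or.inl (by omega)
      · right; rw [pow_succ, ← h3]; ring
    · exact ⟨⟨k, rfl⟩, h2, Or.inl (not_lt.1 h)⟩

omit [DecidableEq S] [DecidableEq V] [DecidableEq O] in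
/-- After `size s` rounds (or more) the doubling loop has reached a power of two `P` with
`s ≤ P < 2 s`. [folklore] -/
theorem dbl_final (s : ℕ) (hs : 1 ≤ s) {t : ℕ} (ht : s.size ≤ t) :
    (∃ k, (dblF s)^[t] 1 = 2 ^ k) ∧ s ≤ (dblF s)^[t] 1 ∧ (dblF s)^[t] 1 < 2 * s := by
  obtain ⟨h1, h2, h3⟩ := dbl_iterate s hs t
  refine ⟨h1, ?_, h2⟩
  rcases h3 with h3 | h3
  · exact h3
  · rw [h3]; exact (Nat.lt_size_self s).le.trans (Nat.pow_le_pow_right (by norm_num) ht)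

variable (L s t : S)

/-- The doubling loop body: `L := 2 L` while `L < s`. [folklore] -/
def dblBody : NCom S V O E := ifLt L s (add L L L) skip

/-- `pow2P L s t`: `L :=` a power of two `P` with `s ≤ P < 2 s` (for `s ≥ 1`), by `size s`
doublings from `1` (`t` is the loop count). [folklore] -/
def pow2P : NCom S V O E := setc L 1 ;ₙ sizeOf t s ;ₙ times t (dblBody L s)

omit [DecidableEq S] [DecidableEq V] [DecidableEq O] in
/-- `pow2P` has no extension calls. [folklore] -/
theorem pow2P_noExt : (pow2P L s t : NCom S V O E).noExt := by simp [pow2P, dblBody, noExt]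

variable {L s}

/-- One round of the doubling loop on the state. [folklore] -/
theorem dblBody_spec (σ : NState S V O) :
    let τ := (dblBody L s : NCom S V O E).eval 𝓔 σ
    τ.sc L = dblF (σ.sc s) (σ.sc L) ∧ (∀ r, r ≠ L → τ.sc r = σ.sc r) ∧ τ.vi = σ.vi ∧ τ.vo = σ.vo ∧
      τ.peak ≤ max σ.peak (τ.sc L) ∧ τ.steps ≤ σ.steps + 2 := by
  intro τ
  unfold dblF
  by_cases h : σ.sc L < σ.sc s
  · have hτ : τ = (add L L L : NCom S V O E).eval 𝓔 (σ.bump 0 1) := eval_ifLt_lt 𝓔 _ _ h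
    rw [if_pos h]
    refine ⟨by simp [hτ, eval], fun r hr => by simp [hτ, eval, hr], by simp [hτ, eval], by simp [hτ, eval], by simp [hτ, eval],
      by simp [hτ, eval]⟩
  · have hτ : τ = σ.bump 0 1 := eval_ifLt_ge 𝓔 _ _ (not_lt.1 h)
    rw [if_neg h]
    exact ⟨by simp [hτ], fun r _ => by simp [hτ], by simp [hτ], by simp [hτ], by simp [hτ], by simp [hτ]⟩

/-- Rounds of the doubling loop on the state. [folklore] -/
theorem dblBody_iterate (hLs : L ≠ s) (σ : NState S V O) :
    ∀ j, let υ := ((dblBody L s : NCom S V O E).eval 𝓔)^[j] σ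
      υ.sc L = (dblF (σ.sc s))^[j] (σ.sc L) ∧ (∀ r, r ≠ L → υ.sc r = σ.sc r) ∧ υ.vi = σ.vi ∧ υ.vo = σ.vo ∧
        υ.peak ≤ max σ.peak (υ.sc L) ∧ υ.steps ≤ σ.steps + 2 * j
  | 0 => ⟨rfl, fun _ _ => rfl, rfl, rfl, le_max_left _ _, by simp⟩
  | j + 1 => by
    obtain ⟨h1, h2, h3, h4, h5, h6⟩ := dblBody_iterate hLs σ j
    intro υ
    set υ₀ := ((dblBody L s : NCom S V O E).eval 𝓔)^[j] σ with hυ₀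
    have hυ : υ = (dblBody L s : NCom S V O E).eval 𝓔 υ₀ := Function.iterate_succ_apply' _ _ _
    obtain ⟨r1, r2, r3, r4, r5, r6⟩ := dblBody_spec 𝓔 υ₀
    have hs : υ₀.sc s = σ.sc s := h2 _ hLs.symm
    rw [hυ]
    refine ⟨by rw [r1, hs, h1, ← Function.iterate_succ_apply' (dblF (σ.sc s))], fun r hr => (r2 r hr).trans (h2 r hr),
      r3.trans h3, r4.trans h4, ?_, by omega⟩
    have hmono : υ₀.sc L ≤ ((dblBody L s : NCom S V O E).eval 𝓔 υ₀).sc L := by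
      rw [r1, dblF]; split_ifs <;> omega
    exact r5.trans (max_le (h5.trans (max_le (le_max_left _ _) (le_max_of_le_right hmono))) (le_max_right _ _))

variable (L s)

/-- The final `peak` of the doubling loop (canonical witness). [folklore] -/
def dblPeak (σ : NState S V O) : ℕ := ((times t (dblBody L s) : NCom S V O E).eval 𝓔 σ).peak

/-- The final `steps` of the doubling loop (canonical witness). [folklore] -/
def dblSteps (σ : NState S V O) : ℕ := ((times t (dblBody L s) : NCom S V O E).eval 𝓔 σ).steps

variable {L s}

/-- **The doubling loop in closed form**, as a rewrite rule (bounds: `dblPeak_le`,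
`dblSteps_le`). [folklore] -/
theorem dblLoop_eq (hLs : L ≠ s) (σ : NState S V O) :
    (times t (dblBody L s) : NCom S V O E).eval 𝓔 σ =
      { σ with sc := Function.update σ.sc L ((dblF (σ.sc s))^[σ.sc t] (σ.sc L)),
               peak := dblPeak 𝓔 L s t σ, steps := dblSteps 𝓔 L s t σ } := by
  obtain ⟨h1, h2, h3, h4, -, -⟩ := dblBody_iterate 𝓔 hLs (σ.bump 0 (σ.sc t + 1)) (σ.sc t)
  simp only [NState.sc_bump, NState.vi_bump, NState.vo_bump] at h1 h2 h3 h4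
  unfold dblPeak dblSteps
  rw [eval_times]
  refine NState.ext ?_ h3 h4 rfl rfl
  funext r; by_cases hr : r = L
  · subst hr; simpa using h1
  · show _ = Function.update σ.sc _ _ r; rw [Function.update_of_ne hr]; exact h2 r hr

/-- The `peak` after the doubling loop. [folklore] -/
theorem dblPeak_le (hLs : L ≠ s) (σ : NState S V O) :
    dblPeak 𝓔 L s t σ ≤ max σ.peak ((dblF (σ.sc s))^[σ.sc t] (σ.sc L)) := by
  obtain ⟨h1, -, -, -, h5, -⟩ := dblBody_iterate 𝓔 hLs (σ.bump 0 (σ.sc t + 1)) (σ.sc t)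
  simp only [NState.sc_bump, NState.peak_bump, Nat.max_zero] at h1 h5
  unfold dblPeak; rw [eval_times, ← h1]; exact h5

/-- The `steps` after the doubling loop. [folklore] -/
theorem dblSteps_le (hLs : L ≠ s) (σ : NState S V O) : dblSteps 𝓔 L s t σ ≤ σ.steps + 3 * σ.sc t + 1 := by
  obtain ⟨-, -, -, -, -, h6⟩ := dblBody_iterate 𝓔 hLs (σ.bump 0 (σ.sc t + 1)) (σ.sc t)
  simp only [NState.steps_bump] at h6
  unfold dblSteps; rw [eval_times]; omega

/-- **Specification of `pow2P`** (for `1 ≤ s`, `L, s, t` distinct): `L := P` with `P` a power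
of two, `s ≤ P < 2 s`; `t := size s`; frame; `peak ≤ max peak (2 s)`; `steps ≤ steps + 3 s + 3`.
[folklore] -/
theorem pow2P_spec (hLs : L ≠ s) (hLt : L ≠ t) (hst : s ≠ t) (σ : NState S V O) (hs : 1 ≤ σ.sc s) :
    let τ := (pow2P L s t : NCom S V O E).eval 𝓔 σ
    (∃ k, τ.sc L = 2 ^ k) ∧ σ.sc s ≤ τ.sc L ∧ τ.sc L < 2 * σ.sc s ∧ τ.sc t = (σ.sc s).size ∧
      (∀ r, r ≠ L → r ≠ t → τ.sc r = σ.sc r) ∧ τ.vi = σ.vi ∧ τ.vo = σ.vo ∧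
      τ.peak ≤ max σ.peak (2 * σ.sc s) ∧ τ.steps ≤ σ.steps + 3 * σ.sc s + 3 := by
  intro τ
  have hτ : τ = (pow2P L s t : NCom S V O E).eval 𝓔 σ := rfl
  simp only [pow2P, eval_seq] at hτ
  rw [dblLoop_eq 𝓔 t hLs] at hτ
  set X₁ := (sizeOf t s : NCom S V O E).eval 𝓔 ((setc L 1 : NCom S V O E).eval 𝓔 σ) with hX₁
  have xs : X₁.sc s = σ.sc s := by simp [hX₁, eval, hLs.symm, hst]
  have xL : X₁.sc L = 1 := by simp [hX₁, eval, hLt]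
  have xt : X₁.sc t = (σ.sc s).size := by simp [hX₁, eval, hLs.symm]
  obtain ⟨hP, hsP, hP2⟩ := dbl_final (σ.sc s) hs (t := (σ.sc s).size) le_rfl
  have hLx : (dblF (X₁.sc s))^[X₁.sc t] (X₁.sc L) = (dblF (σ.sc s))^[(σ.sc s).size] 1 := by rw [xs, xt, xL]
  have hpk := dblPeak_le 𝓔 t hLs X₁
  have hstp := dblSteps_le 𝓔 t hLs X₁
  rw [hLx] at hpk
  rw [xt] at hstp
  have xpk : X₁.peak ≤ max σ.peak (2 * σ.sc s) := by
    have e : X₁.peak = max (max σ.peak 1) (σ.sc s).size := by simp [hX₁, eval, hLs.symm]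
    rw [e]
    have := Nat.size_le.2 (Nat.lt_two_pow_self (n := σ.sc s))
    exact max_le (max_le (le_max_left _ _) (le_max_of_le_right (by omega))) (le_max_of_le_right (by omega))
  have xst : X₁.steps = σ.steps + 2 := by simp [hX₁, eval]
  have hsz : (σ.sc s).size ≤ σ.sc s := Nat.size_le.2 Nat.lt_two_pow_self
  refine ⟨?_, ?_, ?_, ?_, fun r hrL hrt => ?_, ?_, ?_, ?_, ?_⟩
  · rw [hτ]; simpa [hLx] using hP
  · rw [hτ]; simpa [hLx] using hsP
  · rw [hτ]; simpa [hLx] using hP2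
  · rw [hτ]; simp [hLt.symm, xt]
  · rw [hτ]; simp [hrL, hX₁, eval, hrt]
  · rw [hτ]; simp [hX₁, eval]
  · rw [hτ]; simp [hX₁, eval]
  · rw [hτ]; exact hpk.trans (max_le xpk (le_max_of_le_right (by omega)))
  · rw [hτ]; show dblSteps 𝓔 L s t X₁ ≤ _; omega

end Pow2

end NCom

end Literature.Computability.Complexity
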